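import Literature.NumberTheory.NumberFields.QuinticCertCheck
import Literature.NumberTheory.NumberFields.TableAlgebraTruncated
import Literature.NumberTheory.NumberFields.QuinticResidueCerts
import Mathlib.Data.ZMod.Basic
import Mathlib.LinearAlgebra.FreeModule.IdealQuotient
import Mathlib.NumberTheory.NumberField.ClassNumber
import Mathlib.Algebra.Order.Ring.GeomSum
import HarnessLib

/-!
# Soundness of the class-group certificate checker, I: homomorphisms from verified residue vectors

Topic `NumberTheory/NumberFields`. First part of the soundness of `QuinticCertCheck.lean`: the raw
arithmetic is related to Mathlib's (`Nat.beq`, `Int.emod`, …), and a residue vector `h` accepted by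
`FieldData.isHom C m h` yields a ring homomorphism `TAlg S ℤ →+* ZMod m` sending `basis b ↦ h_b`, for
any table `S` whose structure constants are those read by the checker (`Model₀`). Everything is proved.

## References

* H. Cohen, *A Course in Computational Algebraic Number Theory*, GTM 138 (1993), §4.9, §6.5. [folklore]
-/

namespace Literature.NumberTheory.NumberFields

namespace QuinticCert

open TAlg

/-! ### Raw arithmetic versus Mathlib -/

/-- `ibeq` is integer equality. [folklore] -/
theorem ibeq_eq_true_iff (a b : ℤ) : ibeq a b = true ↔ a = b := by
  cases a <;> cases b <;> simp [ibeq]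

/-- `ires a m` casts to `a` in `ZMod m`. [folklore] -/
theorem natCast_ires (a : ℤ) (m : ℕ) (hm : 0 < m) : ((ires a m : ℕ) : ZMod m) = (a : ZMod m) := by
  unfold ires
  have hm' : (Int.ofNat m) ≠ 0 := fun h => hm.ne' (Int.ofNat.inj h)
  have h0 : 0 ≤ Int.emod a (Int.ofNat m) := Int.emod_nonneg _ hm'
  have h1 : ((Int.toNat (Int.emod a (Int.ofNat m)) : ℕ) : ℤ) = Int.emod a (Int.ofNat m) := Int.toNat_of_nonneg h0
  have h2 : ((Int.toNat (Int.emod a (Int.ofNat m)) : ℕ) : ZMod m) = ((Int.emod a (Int.ofNat m) : ℤ) : ZMod m) := by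
    rw [← h1]; simp
  rw [h2]
  show ((a % (m : ℤ) : ℤ) : ZMod m) = _
  exact ZMod.intCast_mod a m

/-- The coordinates of a residue vector as a family. [folklore] -/
def N5.toFin (h : N5) : Fin 5 → ℕ := ![h.c0, h.c1, h.c2, h.c3, h.c4]

/-- The coordinates of an integer quintuple as a family. [folklore] -/
def Z5.toFin (u : Z5) : Fin 5 → ℤ := ![u.c0, u.c1, u.c2, u.c3, u.c4]

/-- `N5.get` is `toFin`. [folklore] -/
theorem N5.get_eq (h : N5) (a : Fin 5) : h.get a = h.toFin a := by
  fin_cases a <;> rfl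

/-- `evalMod u h m` casts to `Σ uₐ hₐ` in `ZMod m`. [folklore] -/
theorem natCast_evalMod (u : Z5) (h : N5) (m : ℕ) (hm : 0 < m) :
    ((Z5.evalMod u h.c0 h.c1 h.c2 h.c3 h.c4 m : ℕ) : ZMod m) = ∑ a : Fin 5, (u.toFin a : ZMod m) * (h.toFin a : ZMod m) := by
  unfold Z5.evalMod
  rw [natCast_ires _ _ hm, Fin.sum_univ_five]
  simp only [Z5.toFin, N5.toFin, Matrix.cons_val_zero, Matrix.cons_val_one, Matrix.head_cons, Matrix.cons_val_two,
    Matrix.tail_cons, Matrix.cons_val_three, Matrix.cons_val_four]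
  show (((u.c0 * (h.c0 : ℤ) + u.c1 * (h.c1 : ℤ) + u.c2 * (h.c2 : ℤ) + u.c3 * (h.c3 : ℤ) + u.c4 * (h.c4 : ℤ) : ℤ)) : ZMod m) = _
  push_cast
  ring

/-! ### Tables read correctly by the checker -/

/-- **The checker's constants read the table `S`**: the structure constants are the coordinates of
`C.tab`, and the unit vector of `S` is `(1, …, 1)` (`1 = g₀ + ⋯ + g₄`). [folklore] -/
structure Reads (C : FieldData) (S : TableSpec 5) : Prop where
  /-- `1 = Σ g_b` -/ one_eq : ∀ a, S.one a = 1
  /-- the checker's table -/ tab_coef : ∀ a b c : Fin 5, (C.tab a b).toFin c = S.T a b c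

section Hom

variable {C : FieldData} {S : TableSpec 5} (hR : Reads C S)
include hR

/-- The residues of an accepted vector form a system for the table in `ZMod m`. [folklore] -/
theorem Reads.isSystem_of_isHom {m : ℕ} (hm : 0 < m) {h : N5} (hh : C.isHom m h = true) :
    S.IsSystem (fun a => (h.toFin a : ZMod m)) := by
  haveI : NeZero m := ⟨hm.ne'⟩
  unfold FieldData.isHom FieldData.homRow at hh
  simp only [Bool.and_eq_true, and_assoc] at hh
  obtain ⟨hone, h00, h01, h02, h03, h04, h10, h11, h12, h13, h14, h20, h21, h22, h23, h24,
    h30, h31, h32, h33, h34, h40, h41, h42, h43, h44⟩ := hh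
  have hall : ∀ a b : Fin 5, C.homEq m h a b = true := by
    intro a b
    fin_cases a <;> fin_cases b <;> assumption
  have hmul : ∀ a b : Fin 5, Nat.mod (Nat.mul (h.get a) (h.get b)) m =
      Z5.evalMod (C.tab a b) h.c0 h.c1 h.c2 h.c3 h.c4 m := fun a b =>
    Nat.eq_of_beq_eq_true (hall a b)
  replace hone : Nat.mod (Nat.add (Nat.add (Nat.add (Nat.add h.c0 h.c1) h.c2) h.c3) h.c4) m = Nat.mod 1 m :=
    Nat.eq_of_beq_eq_true hone
  refine ⟨fun a b => ?_, ?_⟩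
  · have key : ((Nat.mod (Nat.mul (h.get a) (h.get b)) m : ℕ) : ZMod m) =
        ((Z5.evalMod (C.tab a b) h.c0 h.c1 h.c2 h.c3 h.c4 m : ℕ) : ZMod m) := by rw [hmul a b]
    rw [natCast_evalMod _ _ _ hm] at key
    have lhs : ((Nat.mod (Nat.mul (h.get a) (h.get b)) m : ℕ) : ZMod m) = (h.toFin a : ZMod m) * (h.toFin b : ZMod m) := by
      show (((h.get a * h.get b) % m : ℕ) : ZMod m) = _
      rw [ZMod.natCast_mod, Nat.cast_mul, N5.get_eq, N5.get_eq]
    rw [lhs] at key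
    rw [key]
    refine Finset.sum_congr rfl fun c _ => ?_
    rw [← hR.tab_coef a b c, mul_comm]
  · have key : ((Nat.mod (Nat.add (Nat.add (Nat.add (Nat.add h.c0 h.c1) h.c2) h.c3) h.c4) m : ℕ) : ZMod m) =
        ((Nat.mod 1 m : ℕ) : ZMod m) := by rw [hone]
    have e1 : ((Nat.mod (Nat.add (Nat.add (Nat.add (Nat.add h.c0 h.c1) h.c2) h.c3) h.c4) m : ℕ) : ZMod m) =
        ∑ a : Fin 5, (h.toFin a : ZMod m) := by
      show (((h.c0 + h.c1 + h.c2 + h.c3 + h.c4) % m : ℕ) : ZMod m) = _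
      rw [ZMod.natCast_mod, Fin.sum_univ_five]
      simp [N5.toFin]
    have e2 : ((Nat.mod 1 m : ℕ) : ZMod m) = 1 := by
      show (((1 % m : ℕ)) : ZMod m) = 1
      rw [ZMod.natCast_mod, Nat.cast_one]
    rw [e1, e2] at key
    simpa [hR.one_eq] using key

variable [Fact S.IsRing]

/-- **The ring homomorphism `TAlg S ℤ →+* ZMod m` of an accepted residue vector.** [folklore] -/
noncomputable def Reads.homOf {m : ℕ} (hm : 0 < m) {h : N5} (hh : C.isHom m h = true) : TAlg S ℤ →+* ZMod m :=
  TableSpec.lift (hR.isSystem_of_isHom hm hh)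

/-- `homOf` sends `basis a ↦ h_a`. [folklore] -/
theorem Reads.homOf_basis {m : ℕ} (hm : 0 < m) {h : N5} (hh : C.isHom m h = true) (a : Fin 5) :
    hR.homOf hm hh (TAlg.basis a) = (h.toFin a : ZMod m) :=
  TableSpec.lift_basis _ a

/-- `homOf` on an element: `Σ uₐ hₐ`. [folklore] -/
theorem Reads.homOf_apply {m : ℕ} (hm : 0 < m) {h : N5} (hh : C.isHom m h = true) (u : TAlg S ℤ) :
    hR.homOf hm hh u = ∑ a, (u.coef a : ZMod m) * (h.toFin a : ZMod m) :=
  TableSpec.lift_apply _ u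

end Hom

/-! ### Ideals of a number field from verified homomorphisms -/

section Ideals

open Ideal NumberField

variable {C : FieldData} {S : TableSpec 5} [Fact S.IsRing] (hR : Reads C S)
variable {K : Type} [Field K] (e : TAlg S ℤ ≃+* 𝓞 K)

/-- In a Dedekind domain, comparable ideals with the same finite norm are equal. [folklore] -/
theorem eq_of_le_of_absNorm_eq [NumberField K] {I J : Ideal (𝓞 K)} (hle : J ≤ I) (hN : absNorm I = absNorm J)
    (h0 : absNorm J ≠ 0) : J = I := by
  obtain ⟨L, rfl⟩ := Ideal.dvd_iff_le.mpr hle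
  rw [map_mul] at hN h0
  have hI : absNorm I ≠ 0 := fun h => h0 (by rw [h, zero_mul])
  have hL : absNorm L = 1 := by
    have : absNorm I * absNorm L = absNorm I * 1 := by rw [mul_one]; exact hN.symm
    exact mul_left_cancel₀ hI this
  rw [absNorm_eq_one_iff.mp hL, Ideal.mul_top]

include hR

/-- The homomorphism `𝓞 K →+* ZMod m` of an accepted residue vector, transported along `e`. [folklore] -/
noncomputable def Reads.homK {m : ℕ} (hm : 0 < m) {h : N5} (hh : C.isHom m h = true) : 𝓞 K →+* ZMod m :=
  (hR.homOf hm hh).comp e.symm.toRingHom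

/-- `homK (e u) = homOf u`. [folklore] -/
theorem Reads.homK_apply_e {m : ℕ} (hm : 0 < m) {h : N5} (hh : C.isHom m h = true) (u : TAlg S ℤ) :
    hR.homK e hm hh (e u) = hR.homOf hm hh u := by
  simp [Reads.homK]

/-- **The prime ideal of an accepted residue vector modulo a prime `p`**: the kernel of `homK` is a
prime ideal of norm `p` containing `p`. [folklore] -/
theorem Reads.ker_homK_prime [NumberField K] {p : ℕ} (hp : p.Prime) {h : N5} (hh : C.isHom p h = true) :
    (RingHom.ker (hR.homK e hp.pos hh)).IsPrime ∧ absNorm (RingHom.ker (hR.homK e hp.pos hh)) = p ∧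
      ((p : 𝓞 K)) ∈ RingHom.ker (hR.homK e hp.pos hh) := by
  haveI := Fact.mk hp
  set ψ := hR.homK e hp.pos hh
  have hsurj : Function.Surjective ψ := ZMod.ringHom_surjective ψ
  refine ⟨RingHom.ker_isPrime ψ, ?_, ?_⟩
  · rw [absNorm_apply, Submodule.cardQuot_apply]
    have e1 := RingHom.quotientKerEquivOfSurjective hsurj
    have hc : Nat.card (𝓞 K ⧸ RingHom.ker ψ) = Nat.card (ZMod p) := Nat.card_congr e1.toEquiv
    rw [Nat.card_zmod] at hc
    exact hc
  · rw [RingHom.mem_ker, map_natCast, ZMod.natCast_self]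


/-! ### The five primes above a split prime -/

omit [Fact S.IsRing] hR in
/-- A `5`-periodic sequence with a non-zero period is constant. [folklore] -/
theorem const_of_periodic (g : Fin 5 → ℕ) (s : Fin 5) (hs : s ≠ 0) (hper : ∀ b, g (b + s) = g b) (a : Fin 5) :
    g a = g 0 := by
  have h0 := hper 0; have h1 := hper 1; have h2 := hper 2; have h3 := hper 3; have h4 := hper 4
  fin_cases s
  · exact absurd rfl hs
  all_goals
    simp only [Fin.mk_one, Fin.reduceFinMk, Fin.isValue, Fin.reduceAdd, zero_add] at h0 h1 h2 h3 h4
    fin_cases a <;> simp only [Fin.zero_eta, Fin.mk_one, Fin.reduceFinMk, Fin.isValue] <;> omega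

omit [Fact S.IsRing] hR in
/-- `homFor` accepted: the vector is a verified hom modulo `p`, reduced, with first coordinate `r`,
and not constant. [folklore] -/
theorem homFor_spec {p r : ℕ} {ho : Option N5} {h : N5} (hf : C.homFor p r ho = some h) :
    C.isHom p h = true ∧ h.aperiodic = true ∧ h.ltAll p = true := by
  unfold FieldData.homFor at hf
  cases hcand : (cond (Nat.beq (Nat.mod C.D p) 0) ho (some (C.homOfRoot p r))) with
  | none => simp [hcand] at hf
  | some h' =>
    simp only [hcand] at hf
    by_cases hc : (Nat.beq h'.c0 (Nat.mod r p) && C.isHom p h' && h'.aperiodic && h'.ltAll p) = true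
    · simp only [hc, cond_true, Option.some.injEq] at hf
      subst hf
      simp only [Bool.and_eq_true] at hc
      exact ⟨hc.1.1.2, hc.1.2, hc.2⟩
    · simp only [Bool.not_eq_true] at hc
      simp [hc] at hf

omit [Fact S.IsRing] hR in
/-- `ltAll`: all coordinates are reduced. [folklore] -/
theorem toFin_lt_of_ltAll {p : ℕ} {h : N5} (hl : h.ltAll p = true) (a : Fin 5) : h.toFin a < p := by
  unfold N5.ltAll at hl
  simp only [Bool.and_eq_true, Nat.blt_eq] at hl
  obtain ⟨⟨⟨⟨h0, h1⟩, h2⟩, h3⟩, h4⟩ := hl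
  fin_cases a <;> assumption

omit [Fact S.IsRing] hR in
/-- `aperiodic`: the coordinates are not all equal. [folklore] -/
theorem not_const_of_aperiodic {h : N5} (ha : h.aperiodic = true) : ¬ ∀ a, h.toFin a = h.toFin 0 := by
  intro hall
  unfold N5.aperiodic at ha
  have h1 := hall 1; have h2 := hall 2; have h3 := hall 3; have h4 := hall 4
  simp only [N5.toFin, Fin.isValue, Matrix.cons_val_one, Matrix.head_cons, Matrix.cons_val_zero,
    Matrix.cons_val_two, Matrix.tail_cons, Matrix.cons_val_three, Matrix.cons_val_four] at h1 h2 h3 h4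
  simp [h1, h2, h3, h4] at ha

variable (hsym : S.IsSymmetry (Equiv.addRight (4 : Fin 5)))

/-- The inverse shift `g_b ↦ g_{b-1}` of the order (a symmetry of the table). [folklore] -/
def shiftInv : TAlg S ℤ →+* TAlg S ℤ := TAlg.perm (Equiv.addRight (4 : Fin 5)) hsym

omit hR in
/-- `shiftInv^k (basis b) = basis (b + k • 4)`. [folklore] -/
theorem shiftInv_pow_basis (k : ℕ) (b : Fin 5) :
    ((shiftInv hsym) ^ k) (TAlg.basis b) = TAlg.basis (b + k • (4 : Fin 5)) := by
  induction k generalizing b with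
  | zero => simp
  | succ k ih =>
    rw [pow_succ, RingHom.mul_def, RingHom.comp_apply, shiftInv, TAlg.perm_basis, ← shiftInv, ih]
    congr 1
    rw [Equiv.coe_addRight, succ_nsmul, add_assoc, add_comm (4 : Fin 5)]

/-- **The `k`-th conjugate homomorphism** `ψ ∘ shift⁻ᵏ : 𝓞 K →+* ZMod m`. [folklore] -/
noncomputable def Reads.homRot {m : ℕ} (hm : 0 < m) {h : N5} (hh : C.isHom m h = true) (k : ℕ) : 𝓞 K →+* ZMod m :=
  ((hR.homOf hm hh).comp ((shiftInv hsym) ^ k)).comp e.symm.toRingHom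

/-- `homRot k (e (basis b)) = h_{b+4k}`. [folklore] -/
theorem Reads.homRot_basis {m : ℕ} (hm : 0 < m) {h : N5} (hh : C.isHom m h = true) (k : ℕ) (b : Fin 5) :
    hR.homRot e hsym hm hh k (e (TAlg.basis b)) = (h.toFin (b + k • (4 : Fin 5)) : ZMod m) := by
  unfold Reads.homRot
  rw [RingHom.comp_apply, RingHom.comp_apply]
  simp only [RingEquiv.toRingHom_eq_coe, RingEquiv.coe_toRingHom, RingEquiv.symm_apply_apply]
  rw [shiftInv_pow_basis, hR.homOf_basis]

/-- `homRot 0 = homK`. [folklore] -/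
theorem Reads.homRot_zero {m : ℕ} (hm : 0 < m) {h : N5} (hh : C.isHom m h = true) :
    hR.homRot e hsym hm hh 0 = hR.homK e hm hh := by
  unfold Reads.homRot Reads.homK
  rw [pow_zero, RingHom.one_def, RingHom.comp_id]

omit [Fact S.IsRing] hR in
/-- Two ring homomorphisms onto `ZMod p` with the same kernel are equal. [folklore] -/
theorem ringHom_eq_of_ker_eq {R : Type*} [CommRing R] {p : ℕ} (f g : R →+* ZMod p)
    (hker : RingHom.ker f = RingHom.ker g) : f = g := by
  have hf : Function.Surjective f := ZMod.ringHom_surjective f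
  -- `g` factors through `R ⧸ ker f ≃ ZMod p`
  let q : R ⧸ RingHom.ker f →+* ZMod p := Ideal.Quotient.lift (RingHom.ker f) g (fun x hx => by
    rw [hker] at hx; exact hx)
  let iso : R ⧸ RingHom.ker f ≃+* ZMod p := RingHom.quotientKerEquivOfSurjective hf
  have hq : ∀ x, g x = (q.comp iso.symm.toRingHom) (f x) := fun x => by
    simp only [RingHom.coe_comp, RingEquiv.toRingHom_eq_coe, RingHom.coe_coe, Function.comp_apply]
    have : iso.symm (f x) = Ideal.Quotient.mk (RingHom.ker f) x := by
      rw [RingEquiv.symm_apply_eq]; rfl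
    rw [this]; rfl
  have hid : q.comp iso.symm.toRingHom = RingHom.id (ZMod p) := Subsingleton.elim _ _
  ext x
  rw [hq x, hid, RingHom.id_apply]

/-- **The conjugate homomorphisms modulo a prime have pairwise distinct kernels** (the residue vector is
reduced and not constant). [folklore] -/
theorem Reads.ker_homRot_injective {p : ℕ} (hp : p.Prime) {r : ℕ} {ho : Option N5} {h : N5}
    (hf : C.homFor p r ho = some h) {k l : Fin 5}
    (hkl : RingHom.ker (hR.homRot e hsym hp.pos (homFor_spec hf).1 k) =
      RingHom.ker (hR.homRot e hsym hp.pos (homFor_spec hf).1 l)) : k = l := by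
  obtain ⟨hh, hap, hlt⟩ := homFor_spec hf
  have heq := ringHom_eq_of_ker_eq _ _ hkl
  by_contra hne
  apply not_const_of_aperiodic hap
  -- the values: `h (b + k•4) = h (b + l•4)` for all `b`
  have hval : ∀ b : Fin 5, h.toFin (b + (k : ℕ) • (4 : Fin 5)) = h.toFin (b + (l : ℕ) • (4 : Fin 5)) := fun b => by
    have h1 : hR.homRot e hsym hp.pos hh k (e (TAlg.basis b)) = hR.homRot e hsym hp.pos hh l (e (TAlg.basis b)) := by
      rw [heq]
    rw [hR.homRot_basis e hsym hp.pos hh, hR.homRot_basis e hsym hp.pos hh] at h1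
    have := (ZMod.natCast_eq_natCast_iff' _ _ p).mp h1
    rwa [Nat.mod_eq_of_lt (toFin_lt_of_ltAll hlt _), Nat.mod_eq_of_lt (toFin_lt_of_ltAll hlt _)] at this
  -- periodicity with period `s = k•4 - l•4 ≠ 0`
  have hs : ((k : ℕ) • (4 : Fin 5) - (l : ℕ) • (4 : Fin 5)) ≠ 0 := by
    intro h0; apply hne
    fin_cases k <;> fin_cases l <;> first | rfl | (exfalso; revert h0; decide)
  have hper : ∀ b, h.toFin (b + ((k : ℕ) • (4 : Fin 5) - (l : ℕ) • (4 : Fin 5))) = h.toFin b := fun b => by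
    have := hval (b - (l : ℕ) • (4 : Fin 5))
    rwa [sub_add_cancel, show b - (l : ℕ) • (4 : Fin 5) + (k : ℕ) • (4 : Fin 5) =
      b + ((k : ℕ) • (4 : Fin 5) - (l : ℕ) • (4 : Fin 5)) by abel] at this
  exact fun a => const_of_periodic h.toFin _ hs hper a

omit [Fact S.IsRing] hR in
/-- `[𝓞 K : ℤ] = 5` from `[K : ℚ] = 5`. [folklore] -/
theorem absNorm_span_natCast [NumberField K] (hdeg : Module.finrank ℚ K = 5) (p : ℕ) :
    absNorm (span {(p : 𝓞 K)}) = p ^ 5 := by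
  rw [absNorm_span_singleton, show ((p : 𝓞 K)) = algebraMap ℤ (𝓞 K) (p : ℤ) by simp,
    Algebra.norm_algebraMap, RingOfIntegers.rank, hdeg]
  simp [Int.natAbs_pow]

variable [NumberField K]

/-- **`(p) = P₀ P₁ P₂ P₃ P₄`**: the kernels of the five conjugate homomorphisms of an accepted split
record multiply to `(p)`. [folklore] -/
theorem Reads.prod_ker_homRot (hdeg : Module.finrank ℚ K = 5) {p : ℕ} (hp : p.Prime) {r : ℕ} {ho : Option N5}
    {h : N5} (hf : C.homFor p r ho = some h) :
    ∏ k : Fin 5, RingHom.ker (hR.homRot e hsym hp.pos (homFor_spec hf).1 k) = span {(p : 𝓞 K)} := by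
  classical
  haveI := Fact.mk hp
  set P : Fin 5 → Ideal (𝓞 K) := fun k => RingHom.ker (hR.homRot e hsym hp.pos (homFor_spec hf).1 k) with hP
  haveI hmax : ∀ k, (P k).IsMaximal := fun k =>
    RingHom.ker_isMaximal_of_surjective (hR.homRot e hsym hp.pos (homFor_spec hf).1 k) (ZMod.ringHom_surjective _)
  have hcop : ((Finset.univ : Finset (Fin 5)) : Set (Fin 5)).Pairwise (Function.onFun IsCoprime P) := by
    intro k _ l _ hkl
    exact Ideal.isCoprime_of_isMaximal (fun heq => hkl (hR.ker_homRot_injective e hsym hp hf heq))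
  have hprod : ∏ k, P k = ⨅ k, P k := by
    rw [Ideal.prod_eq_iInf_of_pairwise_isCoprime hcop]; simp
  -- `(p) ≤ ∏ P_k`
  have hle : span {(p : 𝓞 K)} ≤ ∏ k, P k := by
    rw [hprod, le_iInf_iff]
    intro k
    rw [span_singleton_le_iff_mem]
    show (p : 𝓞 K) ∈ RingHom.ker (hR.homRot e hsym hp.pos (homFor_spec hf).1 k)
    rw [RingHom.mem_ker, map_natCast, ZMod.natCast_self]
  -- norms: both `p⁵`
  have hNk : ∀ k, absNorm (P k) = p := fun k => by
    have hsurj : Function.Surjective (hR.homRot e hsym hp.pos (homFor_spec hf).1 k) := ZMod.ringHom_surjective _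
    rw [absNorm_apply, Submodule.cardQuot_apply]
    have e1 := RingHom.quotientKerEquivOfSurjective hsurj
    have hc := Nat.card_congr e1.toEquiv
    rw [Nat.card_zmod] at hc
    exact hc
  symm
  refine eq_of_le_of_absNorm_eq hle ?_ ?_
  · rw [map_prod, absNorm_span_natCast hdeg, Finset.prod_congr rfl (fun k _ => hNk k), Finset.prod_const,
      Finset.card_univ, Fintype.card_fin]
  · rw [absNorm_span_natCast hdeg]; exact pow_ne_zero _ hp.ne_zero

/-- **Every prime ideal containing the split prime `p` is one of the five kernels.** [folklore] -/
theorem Reads.exists_eq_ker_homRot (hdeg : Module.finrank ℚ K = 5) {p : ℕ} (hp : p.Prime) {r : ℕ} {ho : Option N5}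
    {h : N5} (hf : C.homFor p r ho = some h) {Q : Ideal (𝓞 K)} [hQ : Q.IsPrime] (hpQ : (p : 𝓞 K) ∈ Q) :
    ∃ k : Fin 5, Q = RingHom.ker (hR.homRot e hsym hp.pos (homFor_spec hf).1 k) := by
  have hle : ∏ k : Fin 5, RingHom.ker (hR.homRot e hsym hp.pos (homFor_spec hf).1 k) ≤ Q := by
    rw [hR.prod_ker_homRot e hsym hdeg hp hf, span_singleton_le_iff_mem]; exact hpQ
  obtain ⟨k, -, hk⟩ := (Ideal.IsPrime.prod_le hQ).mp hle
  haveI := Fact.mk hp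
  haveI : (RingHom.ker (hR.homRot e hsym hp.pos (homFor_spec hf).1 k)).IsMaximal :=
    RingHom.ker_isMaximal_of_surjective (hR.homRot e hsym hp.pos (homFor_spec hf).1 k) (ZMod.ringHom_surjective _)
  exact ⟨k, (Ideal.IsMaximal.eq_of_le inferInstance hQ.ne_top hk).symm⟩


/-! ### The fifth power of a split prime from a homomorphism modulo `p⁵` -/

omit [Fact S.IsRing] hR in
/-- `reducesTo`: the coordinates of `h5` reduce to those of `h` modulo `p`. [folklore] -/
theorem toFin_mod_of_reducesTo {p : ℕ} {h5 h : N5} (hr : h5.reducesTo h p = true) (a : Fin 5) :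
    h5.toFin a % p = h.toFin a := by
  unfold N5.reducesTo at hr
  simp only [Bool.and_eq_true, and_assoc] at hr
  obtain ⟨h0, h1, h2, h3, h4⟩ := hr
  fin_cases a
  · exact Nat.eq_of_beq_eq_true h0
  · exact Nat.eq_of_beq_eq_true h1
  · exact Nat.eq_of_beq_eq_true h2
  · exact Nat.eq_of_beq_eq_true h3
  · exact Nat.eq_of_beq_eq_true h4

omit hR in
/-- `shiftInv⁵ = id`. [folklore] -/
theorem shiftInv_pow_five : (shiftInv hsym) ^ 5 = RingHom.id _ :=
  TableSpec.ringHom_ext fun b => by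
    rw [shiftInv_pow_basis, RingHom.id_apply]
    congr 1
    rw [show (5 : ℕ) • (4 : Fin 5) = 0 by decide, add_zero]

omit [NumberField K] in
/-- **Reduction compatibility**: casting the conjugate homomorphism modulo `p⁵` down to `ZMod p` gives
the conjugate homomorphism modulo `p`. [folklore] -/
theorem Reads.castHom_comp_homRot {p : ℕ} (hp : p.Prime) {h h5 : N5} (hh : C.isHom p h = true)
    (hh5 : C.isHom (p ^ 5) h5 = true) (hr : h5.reducesTo h p = true) (k : ℕ) :
    (ZMod.castHom (dvd_pow_self p (by norm_num) : p ∣ p ^ 5) (ZMod p)).comp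
        (hR.homRot e hsym (pow_pos hp.pos 5) hh5 k) = hR.homRot e hsym hp.pos hh k := by
  -- both are determined by their values on `e (basis b)`
  have key : ((ZMod.castHom (dvd_pow_self p (by norm_num) : p ∣ p ^ 5) (ZMod p)).comp
      ((hR.homOf (pow_pos hp.pos 5) hh5).comp ((shiftInv hsym) ^ k))) =
      (hR.homOf hp.pos hh).comp ((shiftInv hsym) ^ k) := by
    refine TableSpec.ringHom_ext fun b => ?_
    simp only [RingHom.coe_comp, Function.comp_apply]
    rw [shiftInv_pow_basis, hR.homOf_basis, hR.homOf_basis, map_natCast, ← ZMod.natCast_mod (h5.toFin _) p,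
      toFin_mod_of_reducesTo hr]
  unfold Reads.homRot
  rw [← RingHom.comp_assoc, key]

/-- **The kernel modulo `p⁵` is the fifth power of the kernel modulo `p`.** [folklore] -/
theorem Reads.ker_homRot_pow_five {p : ℕ} (hp : p.Prime) {r : ℕ}
    {ho : Option N5} {h h5 : N5} (hf : C.homFor p r ho = some h) (hh5 : C.isHom (p ^ 5) h5 = true)
    (hr : h5.reducesTo h p = true) (k : ℕ) :
    RingHom.ker (hR.homRot e hsym (pow_pos hp.pos 5) hh5 k) =
      (RingHom.ker (hR.homRot e hsym hp.pos (homFor_spec hf).1 k)) ^ 5 := by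
  haveI := Fact.mk hp
  set ψ5 := hR.homRot e hsym (pow_pos hp.pos 5) hh5 k
  set ψ := hR.homRot e hsym hp.pos (homFor_spec hf).1 k
  have hcomp := hR.castHom_comp_homRot e hsym hp (homFor_spec hf).1 hh5 hr k
  -- `P ≤ comap ψ5 (span {p})`
  have h1 : RingHom.ker ψ ≤ (span {(p : ZMod (p ^ 5))}).comap ψ5 := by
    intro x hx
    rw [RingHom.mem_ker] at hx
    rw [Ideal.mem_comap, Ideal.mem_span_singleton]
    have hx' : ZMod.castHom (dvd_pow_self p (by norm_num) : p ∣ p ^ 5) (ZMod p) (ψ5 x) = 0 := by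
      rw [← hx]
      exact (RingHom.congr_fun hcomp x)
    -- an element of `ZMod p⁵` reducing to `0` is a multiple of `p`
    set y := ψ5 x
    rw [ZMod.castHom_apply, ZMod.cast_eq_val, ZMod.natCast_eq_zero_iff] at hx'
    obtain ⟨t, ht⟩ := hx'
    refine ⟨(t : ZMod (p ^ 5)), ?_⟩
    rw [← ZMod.natCast_zmod_val y, ht, Nat.cast_mul]
  -- `P⁵ ≤ ker ψ5`
  have h2 : (RingHom.ker ψ) ^ 5 ≤ RingHom.ker ψ5 := by
    refine (Ideal.pow_right_mono h1 5).trans ((Ideal.le_comap_pow _ 5).trans ?_)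
    have h0 : (span {(p : ZMod (p ^ 5))}) ^ 5 = ⊥ := by
      rw [Ideal.span_singleton_pow, Ideal.span_singleton_eq_bot]
      exact_mod_cast ZMod.natCast_self (p ^ 5)
    rw [h0, ← RingHom.ker_eq_comap_bot]
  -- norms
  have hN5 : absNorm (RingHom.ker ψ5) = p ^ 5 := by
    have hsurj : Function.Surjective ψ5 := ZMod.ringHom_surjective _
    rw [absNorm_apply, Submodule.cardQuot_apply]
    have hc := Nat.card_congr (RingHom.quotientKerEquivOfSurjective hsurj).toEquiv
    rw [Nat.card_zmod] at hc
    exact hc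
  have hN1 : absNorm (RingHom.ker ψ) = p := by
    have hsurj : Function.Surjective ψ := ZMod.ringHom_surjective _
    rw [absNorm_apply, Submodule.cardQuot_apply]
    have hc := Nat.card_congr (RingHom.quotientKerEquivOfSurjective hsurj).toEquiv
    rw [Nat.card_zmod] at hc
    exact hc
  exact (eq_of_le_of_absNorm_eq h2 (by rw [hN5, map_pow, hN1]) (by rw [map_pow, hN1]; exact pow_ne_zero _ hp.ne_zero)).symm

/-! ### The certificate element `β` and its conjugates -/

/-- The element of the order with the given coordinates. [folklore] -/
def toT (S : TableSpec 5) (u : Z5) : TAlg S ℤ := ⟨u.toFin⟩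

omit [Fact S.IsRing] hR in
/-- Coordinates of `toT`. [folklore] -/
@[simp] theorem toT_coef (u : Z5) (a : Fin 5) : (toT S u).coef a = u.toFin a := rfl

/-- **Membership from the checker**: `evalMod β h5 m = 0` puts `toT β` in the kernel of `homOf`.
[folklore] -/
theorem Reads.homOf_toT_eq_zero {m : ℕ} (hm : 0 < m) {h5 : N5} (hh5 : C.isHom m h5 = true) {β : Z5}
    (hmem : Nat.beq (Z5.evalMod β h5.c0 h5.c1 h5.c2 h5.c3 h5.c4 m) 0 = true) :
    hR.homOf hm hh5 (toT S β) = 0 := by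
  have h0 := Nat.eq_of_beq_eq_true hmem
  have := natCast_evalMod β h5 m hm
  rw [h0, Nat.cast_zero] at this
  rw [hR.homOf_apply]
  simpa using this.symm

omit [NumberField K] in
/-- **The conjugate certificate elements**: `shift⁻⁽⁵⁻ᵏ⁾ β` lies in the kernel of the `k`-th conjugate
homomorphism modulo `p⁵`, i.e. in `P_k⁵`. [folklore] -/
theorem Reads.conj_mem_ker_homRot {m : ℕ} (hm : 0 < m) {h5 : N5} (hh5 : C.isHom m h5 = true) {β : Z5}
    (hmem : Nat.beq (Z5.evalMod β h5.c0 h5.c1 h5.c2 h5.c3 h5.c4 m) 0 = true) (k : ℕ) (hk : k ≤ 5) :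
    e (((shiftInv hsym) ^ (5 - k)) (toT S β)) ∈ RingHom.ker (hR.homRot e hsym hm hh5 k) := by
  rw [RingHom.mem_ker]
  unfold Reads.homRot
  simp only [RingHom.coe_comp, RingEquiv.toRingHom_eq_coe, RingEquiv.coe_toRingHom, Function.comp_apply,
    RingEquiv.symm_apply_apply]
  have e1 : ((shiftInv hsym) ^ k) (((shiftInv hsym) ^ (5 - k)) (toT S β)) = toT S β := by
    rw [← RingHom.comp_apply, ← RingHom.mul_def, ← pow_add, show k + (5 - k) = 5 by omega, shiftInv_pow_five,
      RingHom.id_apply]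
  rw [e1]
  exact hR.homOf_toT_eq_zero hm hh5 hmem


/-! ### The relation: `Q²⁵` is principal for every prime `Q` above an accepted split prime -/

/-- **A totally ramified prime package**: an ideal `P` with `P⁵ = (q)` which is the only prime ideal
containing `q`. [folklore] -/
structure RamPrime (K : Type) [Field K] [NumberField K] (q : ℕ) where
  /-- the prime above `q` -/ P : Ideal (𝓞 K)
  /-- total ramification -/ pow_eq : P ^ 5 = Ideal.span {(q : 𝓞 K)}
  /-- uniqueness -/ unique : ∀ Q : Ideal (𝓞 K), Q.IsPrime → (q : 𝓞 K) ∈ Q → Q = P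

omit [Fact S.IsRing] hR in
/-- An ideal all of whose prime divisors are `P₁₁` or `P₂₄₁` is `P₁₁ⁱ P₂₄₁ʲ`. [folklore] -/
theorem exists_eq_pow_mul_pow (R11 : RamPrime K 11) (R241 : RamPrime K 241) (J : Ideal (𝓞 K)) :
    J ≠ ⊥ → (∀ Q : Ideal (𝓞 K), Q.IsPrime → J ≤ Q → Q = R11.P ∨ Q = R241.P) →
      ∃ i j : ℕ, J = R11.P ^ i * R241.P ^ j := by
  refine UniqueFactorizationMonoid.induction_on_prime J (fun h => absurd rfl h) ?_ ?_
  · intro I hI _ _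
    refine ⟨0, 0, ?_⟩
    rw [pow_zero, pow_zero, one_mul, Ideal.one_eq_top]
    exact Ideal.isUnit_iff.mp hI
  · intro I Q hI0 hQ ih _ hfac
    have hQp : Q.IsPrime := Ideal.isPrime_of_prime hQ
    have hQ' : Q = R11.P ∨ Q = R241.P := hfac Q hQp Ideal.mul_le_right
    have hI : ∀ Q' : Ideal (𝓞 K), Q'.IsPrime → I ≤ Q' → Q' = R11.P ∨ Q' = R241.P := fun Q' hQ'p hle =>
      hfac Q' hQ'p (Ideal.mul_le_left.trans hle)
    obtain ⟨i, j, hij⟩ := ih hI0 hI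
    rcases hQ' with rfl | rfl
    · exact ⟨i + 1, j, by rw [hij, pow_succ]; ring⟩
    · exact ⟨i, j + 1, by rw [hij, pow_succ]; ring⟩

omit [Fact S.IsRing] hR [NumberField K] in
/-- A prime ideal containing `11ᵃ · 241ᵇ` contains `11` or `241`. [folklore] -/
theorem mem_or_mem_of_pow_mul_pow_mem {Q : Ideal (𝓞 K)} (hQ : Q.IsPrime) {a b : ℕ}
    (hm : ((11 ^ a * 241 ^ b : ℕ) : 𝓞 K) ∈ Q) : (11 : 𝓞 K) ∈ Q ∨ (241 : 𝓞 K) ∈ Q := by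
  rw [Nat.cast_mul, Nat.cast_pow, Nat.cast_pow] at hm
  rcases hQ.mem_or_mem hm with h | h
  · left
    by_cases ha : a = 0
    · rw [ha, pow_zero] at h; exact absurd (Q.eq_top_of_isUnit_mem h isUnit_one) hQ.ne_top
    · exact_mod_cast hQ.mem_of_pow_mem a h
  · right
    by_cases hb : b = 0
    · rw [hb, pow_zero] at h; exact absurd (Q.eq_top_of_isUnit_mem h isUnit_one) hQ.ne_top
    · exact_mod_cast hQ.mem_of_pow_mem b h

omit [Fact S.IsRing] hR in
/-- `signed neg n` has absolute value `n`. [folklore] -/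
theorem natAbs_signed (neg : Bool) (n : ℕ) : (signed neg n).natAbs = n := by
  cases neg <;> simp [signed, Int.negOfNat_eq]

variable (hnorm : ∀ (u : Z5) (n : ℤ), (Z5.norm C.mul u).isConst n = true → Algebra.norm ℤ (e (toT S u)) = n)
variable (hnormShift : ∀ u : TAlg S ℤ, Algebra.norm ℤ (e (shiftInv hsym u)) = Algebra.norm ℤ (e u))
include hnorm hnormShift

omit [NumberField K] hR in
/-- Norm of a shifted certificate element. [folklore] -/
theorem norm_shiftInv_pow_toT (u : Z5) (n : ℤ) (hc : (Z5.norm C.mul u).isConst n = true) (j : ℕ) :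
    Algebra.norm ℤ (e (((shiftInv hsym) ^ j) (toT S u))) = n := by
  induction j with
  | zero => simpa using hnorm u n hc
  | succ j ih => rw [pow_succ', RingHom.mul_def, RingHom.comp_apply, hnormShift, ih]

/-- **The fifth-power relation.** If the split record of `p` is accepted, then for every prime ideal `Q`
above `p`, `Q²⁵` is principal: `Q⁵ · J = (x)` with `x` a conjugate of `β`, where `J` has norm
`11ᵃ 241ᵇ` and hence is `P₁₁ⁱ P₂₄₁ʲ`, whose fifth power is principal. [folklore] -/
theorem Reads.pow_isPrincipal_of_split (R11 : RamPrime K 11) (R241 : RamPrime K 241) (hdeg : Module.finrank ℚ K = 5)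
    {M p r : ℕ} {ho h5o : Option N5} {β : Z5} {a b : ℕ} {neg : Bool} (hp : p.Prime)
    (hrec : C.checkRec M (Rec.split p r ho h5o β a b neg) = true) {Q : Ideal (𝓞 K)} [hQ : Q.IsPrime]
    (hpQ : (p : 𝓞 K) ∈ Q) : (Q ^ 25).IsPrincipal := by
  classical
  haveI := Fact.mk hp
  -- unpack the record check
  unfold FieldData.checkRec at hrec
  cases hf : C.homFor p r ho with
  | none => simp [hf] at hrec
  | some h =>
    simp only [hf] at hrec
    cases h5c : (cond (Nat.beq (Nat.mod C.D p) 0) h5o (some (C.hom5OfRoot p r))) with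
    | none => simp [h5c] at hrec
    | some h5 =>
      simp only [h5c, Bool.and_eq_true] at hrec
      obtain ⟨⟨⟨hh5, hred⟩, hconst⟩, hmem⟩ := hrec
      have hh5' : C.isHom (p ^ 5) h5 = true := hh5
      -- the prime `Q` is a conjugate kernel
      obtain ⟨k, rfl⟩ := hR.exists_eq_ker_homRot e hsym hdeg hp hf hpQ
      set P := RingHom.ker (hR.homRot e hsym hp.pos (homFor_spec hf).1 k) with hPdef
      -- the element `x ∈ P⁵`
      set x : 𝓞 K := e (((shiftInv hsym) ^ (5 - (k : ℕ))) (toT S β)) with hxdef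
      have hxmem : x ∈ P ^ 5 := by
        rw [hPdef, ← hR.ker_homRot_pow_five e hsym hp hf hh5' hred k]
        exact hR.conj_mem_ker_homRot e hsym (pow_pos hp.pos 5) hh5' hmem k (by omega)
      have hNx : Algebra.norm ℤ x = signed neg (Nat.mul (Nat.mul (Nat.pow p 5) (Nat.pow 11 a)) (Nat.pow 241 b)) :=
        norm_shiftInv_pow_toT (S := S) e hsym hnorm hnormShift β _ hconst _
      have hN : absNorm (span {x}) = p ^ 5 * (11 ^ a * 241 ^ b) := by
        rw [absNorm_span_singleton, hNx, natAbs_signed]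
        show p ^ 5 * 11 ^ a * 241 ^ b = _
        ring
      -- `(x) = P⁵ · J`
      obtain ⟨J, hJ⟩ := Ideal.dvd_iff_le.mpr ((span_singleton_le_iff_mem _).mpr hxmem)
      have hNP : absNorm P = p := by
        have hsurj : Function.Surjective (hR.homRot e hsym hp.pos (homFor_spec hf).1 k) := ZMod.ringHom_surjective _
        rw [hPdef, absNorm_apply, Submodule.cardQuot_apply]
        have hc := Nat.card_congr (RingHom.quotientKerEquivOfSurjective hsurj).toEquiv
        rw [Nat.card_zmod] at hc
        exact hc
      have hNJ : absNorm J = 11 ^ a * 241 ^ b := by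
        have h1 := hN
        rw [hJ, map_mul, map_pow, hNP] at h1
        exact mul_left_cancel₀ (pow_ne_zero 5 hp.ne_zero) h1
      have hJ0 : J ≠ ⊥ := fun h0 => by
        rw [h0, absNorm_bot] at hNJ
        exact absurd hNJ.symm (by positivity)
      -- the prime divisors of `J` are `P₁₁`, `P₂₄₁`
      have hfac : ∀ Q' : Ideal (𝓞 K), Q'.IsPrime → J ≤ Q' → Q' = R11.P ∨ Q' = R241.P := by
        intro Q' hQ' hle
        have hm : ((11 ^ a * 241 ^ b : ℕ) : 𝓞 K) ∈ Q' := by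
          rw [← hNJ]; exact hle (absNorm_mem J)
        rcases mem_or_mem_of_pow_mul_pow_mem hQ' hm with h11 | h241
        · exact Or.inl (R11.unique Q' hQ' h11)
        · exact Or.inr (R241.unique Q' hQ' h241)
      obtain ⟨i, j, hij⟩ := exists_eq_pow_mul_pow R11 R241 J hJ0 hfac
      -- `P²⁵ · (c) = (x⁵)` with `c = 11ⁱ 241ʲ`
      set c : 𝓞 K := (11 : 𝓞 K) ^ i * (241 : 𝓞 K) ^ j with hcdef
      have hJ5 : J ^ 5 = span {c} := by
        rw [hij, mul_pow, ← pow_mul, ← pow_mul, mul_comm i 5, mul_comm j 5, pow_mul, pow_mul, R11.pow_eq,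
          R241.pow_eq, Ideal.span_singleton_pow, Ideal.span_singleton_pow, Ideal.span_singleton_mul_span_singleton]
        norm_num [hcdef]
      have hkey : P ^ 25 * span {c} = span {x ^ 5} := by
        rw [← Ideal.span_singleton_pow, hJ, mul_pow, ← pow_mul, hJ5]
      -- `c ∣ x⁵`, so `P²⁵ = (x⁵ / c)`
      have hc0 : c ≠ 0 := by
        rw [hcdef]; exact mul_ne_zero (pow_ne_zero _ (by norm_num)) (pow_ne_zero _ (by norm_num))
      have hdvd : x ^ 5 ∈ span {c} := by
        have : span {x ^ 5} ≤ span {c} := by rw [← hkey]; exact Ideal.mul_le_left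
        exact (span_singleton_le_iff_mem _).mp this
      obtain ⟨y, hy⟩ := Ideal.mem_span_singleton'.mp hdvd
      refine ⟨⟨y, ?_⟩⟩
      have h2 : P ^ 25 * span {c} = span {y} * span {c} := by
        rw [hkey, ← hy, Ideal.span_singleton_mul_span_singleton, mul_comm]
      have hc0' : span {c} ≠ (0 : Ideal (𝓞 K)) := by
        rw [Ne, Ideal.zero_eq_bot, Ideal.span_singleton_eq_bot]; exact hc0
      have := mul_right_cancel₀ hc0' h2
      rw [this, Ideal.submodule_span_eq]

end Ideals

/-! ### Inert primes: the arithmetic bridge to `QuinticRing` -/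

section Bridge

/-- Raw `Nat.mod` is `%`. [folklore] -/
theorem rawMod (a b : ℕ) : Nat.mod a b = a % b := rfl
/-- Raw `Nat.add` is `+`. [folklore] -/
theorem rawAdd (a b : ℕ) : Nat.add a b = a + b := rfl
/-- Raw `Nat.mul` is `*`. [folklore] -/
theorem rawMul (a b : ℕ) : Nat.mul a b = a * b := rfl
/-- Raw `Nat.div` is `/`. [folklore] -/
theorem rawDiv (a b : ℕ) : Nat.div a b = a / b := rfl
/-- Raw `Nat.sub` is `-`. [folklore] -/
theorem rawSub (a b : ℕ) : Nat.sub a b = a - b := rfl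
/-- Raw `Nat.pow` is `^`. [folklore] -/
theorem rawPow (a b : ℕ) : Nat.pow a b = a ^ b := rfl
/-- Raw `Nat.land` is `&&&`. [folklore] -/
theorem rawLand (a b : ℕ) : Nat.land a b = a &&& b := rfl
/-- Raw `Nat.shiftRight` is `>>>`. [folklore] -/
theorem rawShiftRight (a b : ℕ) : Nat.shiftRight a b = a >>> b := rfl
/-- Raw `Nat.shiftLeft` is `<<<`. [folklore] -/
theorem rawShiftLeft (a b : ℕ) : Nat.shiftLeft a b = a <<< b := rfl

variable {p : ℕ} [Fact p.Prime]

/-- A residue quintuple as an element of `𝔽_p[t]/(t⁵ - P₄t⁴ - ⋯ - P₀)`. [folklore] -/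
def toQ (P0 P1 P2 P3 P4 : ZMod p) (u : N5) : QuinticRing (ZMod p) P0 P1 P2 P3 P4 :=
  ⟨u.c0, u.c1, u.c2, u.c3, u.c4⟩

/-- The residues of the reduction data. [folklore] -/
def RedData.Pz (d : RedData) (i : Fin 5) : ZMod p := ((![d.P0, d.P1, d.P2, d.P3, d.P4] i : ℕ) : ZMod p)

/-- **`mulR` is multiplication in `QuinticRing (ZMod p)`.** [folklore] -/
theorem toQ_mulR (d : RedData) (hd : d.p = p) (u v : N5) :
    toQ (d.P0 : ZMod p) d.P1 d.P2 d.P3 d.P4 (N5.mulR d u v) =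
      toQ (d.P0 : ZMod p) d.P1 d.P2 d.P3 d.P4 u * toQ (d.P0 : ZMod p) d.P1 d.P2 d.P3 d.P4 v := by
  subst hd
  ext <;>
  · simp only [toQ, N5.mulR, QuinticRing.mul_c0, QuinticRing.mul_c1, QuinticRing.mul_c2, QuinticRing.mul_c3,
      QuinticRing.mul_c4, QuinticRing.q0, QuinticRing.q1, QuinticRing.q2, QuinticRing.q3]
    simp only [rawMod, rawAdd, rawMul]
    push_cast [ZMod.natCast_mod]
    ring

/-- **`powR` is a power.** [folklore] -/
theorem toQ_powR (d : RedData) (hd : d.p = p) (bs : List Bool) (x : N5) :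
    toQ (d.P0 : ZMod p) d.P1 d.P2 d.P3 d.P4 (N5.powR d bs x) =
      toQ (d.P0 : ZMod p) d.P1 d.P2 d.P3 d.P4 x ^ QuinticRing.ofBits bs := by
  induction bs generalizing x with
  | nil =>
    subst hd
    ext <;> simp [toQ, N5.powR, QuinticRing.ofBits, rawMod]
  | cons b bs ih =>
    have key : toQ (d.P0 : ZMod p) d.P1 d.P2 d.P3 d.P4 (N5.powR d bs (N5.mulR d x x)) =
        toQ (d.P0 : ZMod p) d.P1 d.P2 d.P3 d.P4 x ^ (2 * QuinticRing.ofBits bs) := by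
      rw [ih, toQ_mulR d hd, ← sq, ← pow_mul]
    cases b
    · simp only [N5.powR, cond_false, QuinticRing.ofBits, Bool.false_eq_true, ↓reduceIte, zero_add]
      exact key
    · simp only [N5.powR, cond_true, QuinticRing.ofBits, ↓reduceIte]
      rw [toQ_mulR d hd, key, pow_add, pow_one]

omit [Fact p.Prime] in
/-- `ofBits (bitsF fuel n) = n` for `n < 2^fuel`. [folklore] -/
theorem ofBits_bitsF (fuel n : ℕ) (h : n < 2 ^ fuel) : QuinticRing.ofBits (bitsF fuel n) = n := by
  induction fuel generalizing n with
  | zero => simp at h; subst h; rfl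
  | succ fuel ih =>
    unfold bitsF
    by_cases h0 : n = 0
    · subst h0; rfl
    · have hb : Nat.beq n 0 = false := by
        cases h' : Nat.beq n 0
        · rfl
        · exact absurd (Nat.eq_of_beq_eq_true h') h0
      rw [hb, cond_false, QuinticRing.ofBits, ih (Nat.div n 2) (by rw [rawDiv]; omega)]
      rw [rawDiv, rawMod]
      by_cases h1 : n % 2 = 1
      · have : Nat.beq (n % 2) 1 = true := by rw [h1]; rfl
        rw [this]; simp; omega
      · have : Nat.beq (n % 2) 1 = false := by
          cases h' : Nat.beq (n % 2) 1
          · rfl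
          · exact absurd (Nat.eq_of_beq_eq_true h') h1
        rw [this]; simp; omega

/-- `isOne`: the quintuple is `1`. [folklore] -/
theorem toQ_eq_one_of_isOne {P0 P1 P2 P3 P4 : ZMod p} {u : N5} (h : FieldPoly.isOne p u = true) :
    toQ P0 P1 P2 P3 P4 u = 1 := by
  unfold FieldPoly.isOne at h
  simp only [Bool.and_eq_true, and_assoc] at h
  obtain ⟨h0, h1, h2, h3, h4⟩ := h
  have e0 := Nat.eq_of_beq_eq_true h0; have e1 := Nat.eq_of_beq_eq_true h1
  have e2 := Nat.eq_of_beq_eq_true h2; have e3 := Nat.eq_of_beq_eq_true h3; have e4 := Nat.eq_of_beq_eq_true h4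
  ext
  · show ((u.c0 : ℕ) : ZMod p) = 1
    rw [e0]; show (((1 % p : ℕ)) : ZMod p) = 1; rw [ZMod.natCast_mod, Nat.cast_one]
  · show ((u.c1 : ℕ) : ZMod p) = 0; rw [e1, Nat.cast_zero]
  · show ((u.c2 : ℕ) : ZMod p) = 0; rw [e2, Nat.cast_zero]
  · show ((u.c3 : ℕ) : ZMod p) = 0; rw [e3, Nat.cast_zero]
  · show ((u.c4 : ℕ) : ZMod p) = 0; rw [e4, Nat.cast_zero]

/-- `minusT`: subtracting the generator `t`. [folklore] -/
theorem toQ_minusT {P0 P1 P2 P3 P4 : ZMod p} (w : N5) :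
    toQ P0 P1 P2 P3 P4 (FieldPoly.minusT p w) = toQ P0 P1 P2 P3 P4 w - QuinticRing.gen (ZMod p) P0 P1 P2 P3 P4 := by
  have hp : 0 < p := (Fact.out : p.Prime).pos
  ext
  · simp [toQ, FieldPoly.minusT, QuinticRing.gen]
  · simp only [toQ, FieldPoly.minusT, QuinticRing.gen, QuinticRing.sub_c1]
    show (((w.c1 + (p - 1 % p)) % p : ℕ) : ZMod p) = (w.c1 : ZMod p) - 1
    rw [ZMod.natCast_mod, Nat.cast_add]
    have h1 : ((p - 1 % p : ℕ) : ZMod p) = -1 := by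
      rcases Nat.lt_or_ge 1 p with hlt | hle
      · rw [Nat.mod_eq_of_lt hlt, Nat.cast_sub hlt.le, ZMod.natCast_self, Nat.cast_one, zero_sub]
      · have : p = 1 := by omega
        subst this
        exact Subsingleton.elim _ _
    rw [h1]; ring
  · simp [toQ, FieldPoly.minusT, QuinticRing.gen]
  · simp [toQ, FieldPoly.minusT, QuinticRing.gen]
  · simp [toQ, FieldPoly.minusT, QuinticRing.gen]

/-- The generator `t` as a quintuple. [folklore] -/
theorem toQ_t {P0 P1 P2 P3 P4 : ZMod p} :
    toQ P0 P1 P2 P3 P4 ⟨0, Nat.mod 1 p, 0, 0, 0⟩ = QuinticRing.gen (ZMod p) P0 P1 P2 P3 P4 := by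
  ext <;> simp [toQ, QuinticRing.gen, rawMod]

/-- **Soundness of the no-root certificate**: `f̄` has no root in `𝔽_p`. [folklore] -/
theorem not_isRoot_of_noRootCert (f : FieldPoly) (hp64 : p < 2 ^ 64) {s : N5} (h : f.noRootCert p s = true)
    (r : ZMod p) :
    ¬ (QuinticRing.poly ((f.red p).P0 : ZMod p) (f.red p).P1 (f.red p).P2 (f.red p).P3 (f.red p).P4).IsRoot r := by
  have hd : (f.red p).p = p := rfl
  unfold FieldPoly.noRootCert at h
  have h1 := toQ_eq_one_of_isOne (P0 := ((f.red p).P0 : ZMod p)) (P1 := (f.red p).P1) (P2 := (f.red p).P2)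
    (P3 := (f.red p).P3) (P4 := (f.red p).P4) h
  rw [toQ_mulR _ hd, toQ_minusT, FieldPoly.tPow, toQ_powR _ hd, toQ_t, ← QuinticRing.powL_eq_pow] at h1
  have hbs : QuinticRing.ofBits (bitsF 64 p) = Fintype.card (ZMod p) := by rw [ofBits_bitsF 64 p hp64, ZMod.card]
  exact QuinticRing.not_isRoot_of_noRootCert _ _ _ _ _ hbs _ h1 r

/-- **Soundness of the irreducibility certificate**: `f̄` is irreducible over `𝔽_p`. [folklore] -/
theorem irreducible_of_irredCert (f : FieldPoly) (hp64 : p < 2 ^ 64) {s2 : N5} (h : f.irredCert p s2 = true) :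
    Irreducible (QuinticRing.poly ((f.red p).P0 : ZMod p) (f.red p).P1 (f.red p).P2 (f.red p).P3 (f.red p).P4) := by
  have hd : (f.red p).p = p := rfl
  unfold FieldPoly.irredCert at h
  have h1 := toQ_eq_one_of_isOne (P0 := ((f.red p).P0 : ZMod p)) (P1 := (f.red p).P1) (P2 := (f.red p).P2)
    (P3 := (f.red p).P3) (P4 := (f.red p).P4) h
  rw [toQ_mulR _ hd, toQ_minusT, toQ_powR _ hd, toQ_powR _ hd, toQ_t, ← QuinticRing.powL_eq_pow,
    ← QuinticRing.powL_eq_pow] at h1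
  have hbs : QuinticRing.ofBits (bitsF 64 p) = Fintype.card (ZMod p) := by rw [ofBits_bitsF 64 p hp64, ZMod.card]
  exact QuinticRing.irreducible_poly_of_powCert _ _ _ _ _ hbs _ h1

/-- The residues of the reduction data are `-aᵢ`. [folklore] -/
theorem red_P_eq (f : FieldPoly) :
    (((f.red p).P0 : ℕ) : ZMod p) = -(f.a0 : ZMod p) ∧ (((f.red p).P1 : ℕ) : ZMod p) = -(f.a1 : ZMod p) ∧
      (((f.red p).P2 : ℕ) : ZMod p) = -(f.a2 : ZMod p) ∧ (((f.red p).P3 : ℕ) : ZMod p) = -(f.a3 : ZMod p) ∧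
      (((f.red p).P4 : ℕ) : ZMod p) = -(f.a4 : ZMod p) := by
  have hp : 0 < p := (Fact.out : p.Prime).pos
  simp only [FieldPoly.red]
  refine ⟨?_, ?_, ?_, ?_, ?_⟩ <;>
  · rw [natCast_ires _ _ hp]
    exact Int.cast_neg _

/-- A root of `f̄` in the monic form `r⁵ + a₄r⁴ + ⋯ + a₀ = 0` is a root of `QuinticRing.poly`. [folklore] -/
theorem isRoot_poly_of_eval (f : FieldPoly) {r : ZMod p}
    (hr : r ^ 5 + (f.a4 : ZMod p) * r ^ 4 + (f.a3 : ZMod p) * r ^ 3 + (f.a2 : ZMod p) * r ^ 2 +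
      (f.a1 : ZMod p) * r + (f.a0 : ZMod p) = 0) :
    (QuinticRing.poly ((f.red p).P0 : ZMod p) (f.red p).P1 (f.red p).P2 (f.red p).P3 (f.red p).P4).IsRoot r := by
  obtain ⟨e0, e1, e2, e3, e4⟩ := red_P_eq (p := p) f
  simp only [Polynomial.IsRoot, QuinticRing.poly, Polynomial.eval_sub, Polynomial.eval_pow, Polynomial.eval_X,
    Polynomial.eval_mul, Polynomial.eval_C, e0, e1, e2, e3, e4]
  linear_combination hr

end Bridge


/-! ### Inert primes in the number field -/

section InertNF

open Ideal NumberField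

variable {C : FieldData} {S : TableSpec 5} [Fact S.IsRing] (hR : Reads C S)
variable {K : Type} [Field K] [NumberField K] (e : TAlg S ℤ ≃+* 𝓞 K)
variable (hf0 : (TAlg.basis 0 : TAlg S ℤ) ^ 5 + (C.f.a4 : TAlg S ℤ) * TAlg.basis 0 ^ 4 +
    (C.f.a3 : TAlg S ℤ) * TAlg.basis 0 ^ 3 + (C.f.a2 : TAlg S ℤ) * TAlg.basis 0 ^ 2 +
    (C.f.a1 : TAlg S ℤ) * TAlg.basis 0 + (C.f.a0 : TAlg S ℤ) = 0)
include hf0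

/-- A ring homomorphism `TAlg S ℤ →+* ZMod p` sends `basis 0` to a root of `f̄`. [folklore] -/
theorem isRoot_of_ringHom {p : ℕ} [Fact p.Prime] (ψ : TAlg S ℤ →+* ZMod p) :
    (QuinticRing.poly ((C.f.red p).P0 : ZMod p) (C.f.red p).P1 (C.f.red p).P2 (C.f.red p).P3 (C.f.red p).P4).IsRoot
      (ψ (TAlg.basis 0)) := by
  apply isRoot_poly_of_eval
  have h := congrArg ψ hf0
  simp only [map_add, map_mul, map_pow, map_intCast, map_zero] at h
  exact h

include e

/-- **No prime ideal of norm `p`** when the no-root certificate of `p` is accepted. [folklore] -/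
theorem no_prime_of_absNorm_eq {p : ℕ} (hp : p.Prime) (hp64 : p < 2 ^ 64) {s : N5} (hcert : C.f.noRootCert p s = true)
    {Q : Ideal (𝓞 K)} [Q.IsPrime] (hN : absNorm Q = p) : False := by
  haveI := Fact.mk hp
  have hQ0 : Q ≠ ⊥ := fun h => by rw [h, absNorm_bot] at hN; exact hp.ne_zero hN.symm
  haveI : Finite (𝓞 K ⧸ Q) := Ideal.finiteQuotientOfFreeOfNeBot Q hQ0
  letI : Fintype (𝓞 K ⧸ Q) := Fintype.ofFinite _
  have hcard : Fintype.card (𝓞 K ⧸ Q) = p := by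
    rw [← Nat.card_eq_fintype_card, ← Submodule.cardQuot_apply, ← absNorm_apply, hN]
  let φ : (𝓞 K ⧸ Q) ≃+* ZMod p := (ZMod.ringEquivOfPrime (𝓞 K ⧸ Q) hp hcard).symm
  let ψ : TAlg S ℤ →+* ZMod p := (φ.toRingHom.comp (Ideal.Quotient.mk Q)).comp e.toRingHom
  exact not_isRoot_of_noRootCert C.f hp64 hcert _ (isRoot_of_ringHom hf0 ψ)

/-- **Inert prime with `p² > M`**: no prime ideal containing `p` has norm `≤ M`. [folklore] -/
theorem no_prime_le_of_inert_large (hdeg : Module.finrank ℚ K = 5) {M p : ℕ} (hp : p.Prime) (hp64 : p < 2 ^ 64)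
    {s : N5} (hcert : C.f.noRootCert p s = true) (hM : M < p * p)
    {Q : Ideal (𝓞 K)} [hQ : Q.IsPrime] (hpQ : (p : 𝓞 K) ∈ Q) (hQM : absNorm Q ≤ M) : False := by
  -- `absNorm Q ∣ p⁵`
  have hdvd : absNorm Q ∣ p ^ 5 := by
    rw [← absNorm_span_natCast (K := K) hdeg p]
    exact absNorm_dvd_absNorm_of_le ((span_singleton_le_iff_mem _).mpr hpQ)
  obtain ⟨i, hi, hNi⟩ := (Nat.dvd_prime_pow hp).mp hdvd
  have hi0 : i ≠ 0 := fun h0 => by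
    rw [h0, pow_zero, absNorm_eq_one_iff] at hNi
    exact hQ.ne_top hNi
  have hi1 : i = 1 := by
    by_contra hne
    have h2 : 2 ≤ i := by omega
    have : p * p ≤ absNorm Q := by
      rw [hNi]
      calc p * p = p ^ 2 := (sq p).symm
        _ ≤ p ^ i := Nat.pow_le_pow_right hp.pos h2
    omega
  rw [hi1, pow_one] at hNi
  exact no_prime_of_absNorm_eq e hf0 hp hp64 hcert hNi

omit e hf0 [NumberField K] in
/-- `TAlg.map` fixes the basis. [folklore] -/
theorem map_basis {R' : Type*} [CommRing R'] (g : ℤ →+* R') (a : Fin 5) :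
    TAlg.map g (TAlg.basis a : TAlg S ℤ) = TAlg.basis a := by
  ext b
  simp [TAlg.map_coef, TAlg.basis_coef, apply_ite g]

omit e hf0 [NumberField K] in
/-- `TAlg.map` on integer constants. [folklore] -/
theorem map_intCast' {R' : Type*} [CommRing R'] (g : ℤ →+* R') (m : ℤ) :
    TAlg.map g (m : TAlg S ℤ) = TAlg.const (g m) := by
  ext b
  simp [TAlg.intCast_coef]

omit [NumberField K] in
include hR in
/-- **Inert prime with `p² ≤ M`: `(p)` is a maximal ideal**, by the field criterion for `Λ/pΛ`
(`f̄` irreducible, `g₀` generates since `p ∤ D`), so every prime containing `p` is `(p)`. [folklore] -/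
theorem eq_span_of_inert_small {p : ℕ} (hp : p.Prime) (hp64 : p < 2 ^ 64) (hD : ¬ p ∣ C.D)
    (hDex : ∀ b : Fin 5, ∃ c : Fin 5 → ℤ,
      (C.D : TAlg S ℤ) * TAlg.basis b = ∑ k : Fin 5, (c k : TAlg S ℤ) * TAlg.basis 0 ^ (k : ℕ))
    {s2 : N5} (hcert2 : C.f.irredCert p s2 = true)
    {Q : Ideal (𝓞 K)} [hQ : Q.IsPrime] (hpQ : (p : 𝓞 K) ∈ Q) : Q = span {(p : 𝓞 K)} := by
  classical
  haveI := Fact.mk hp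
  set red : TAlg S ℤ →+* TAlg S (ZMod p) := TAlg.map (Int.castRingHom (ZMod p)) with hred
  -- the field criterion
  have hF : IsField (TAlg S (ZMod p)) := by
    have hirr := irreducible_of_irredCert C.f hp64 hcert2
    obtain ⟨e0, e1, e2, e3, e4⟩ := red_P_eq (p := p) C.f
    -- the relation of `γ = basis 0`
    have hrel : (TAlg.basis 0 : TAlg S (ZMod p)) ^ 5 =
        TAlg.const (((C.f.red p).P4 : ℕ) : ZMod p) * TAlg.basis 0 ^ 4 +
        TAlg.const (((C.f.red p).P3 : ℕ) : ZMod p) * TAlg.basis 0 ^ 3 +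
        TAlg.const (((C.f.red p).P2 : ℕ) : ZMod p) * TAlg.basis 0 ^ 2 +
        TAlg.const (((C.f.red p).P1 : ℕ) : ZMod p) * TAlg.basis 0 +
        TAlg.const (((C.f.red p).P0 : ℕ) : ZMod p) := by
      have h := congrArg red hf0
      simp only [map_add, map_mul, map_pow, map_zero, hred, map_basis, map_intCast', Int.coe_castRingHom] at h
      rw [e0, e1, e2, e3, e4, map_neg, map_neg, map_neg, map_neg, map_neg]
      linear_combination h
    -- the coordinate certificate
    have hDu : IsUnit ((C.D : ℕ) : ZMod p) := by
      rw [isUnit_iff_ne_zero, Ne, ZMod.natCast_eq_zero_iff]; exact hD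
    choose c hc using hDex
    refine TAlg.isField_of_generator (TAlg.basis 0) _ _ _ _ _ hrel hirr
      (fun b k => ((C.D : ℕ) : ZMod p)⁻¹ * ((c b k : ℤ) : ZMod p)) (fun b => ?_) ?_
    · have h := congrArg red (hc b)
      simp only [map_mul, map_sum, map_pow, hred, map_basis, map_intCast', map_natCast, Int.coe_castRingHom] at h
      -- `D · basis b = Σ const (c k) γ^k`; multiply by `D⁻¹`
      have hD' : (TAlg.const (((C.D : ℕ) : ZMod p)⁻¹) : TAlg S (ZMod p)) * ((C.D : ℕ) : TAlg S (ZMod p)) = 1 := by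
        rw [show ((C.D : ℕ) : TAlg S (ZMod p)) = TAlg.const ((C.D : ℕ) : ZMod p) by ext a; simp, ← map_mul,
          inv_mul_cancel₀ hDu.ne_zero, map_one]
      calc (TAlg.basis b : TAlg S (ZMod p))
          = TAlg.const (((C.D : ℕ) : ZMod p)⁻¹) * (((C.D : ℕ) : TAlg S (ZMod p)) * TAlg.basis b) := by
            rw [← mul_assoc, hD', one_mul]
        _ = _ := by
            rw [h, Finset.mul_sum]
            refine Finset.sum_congr rfl fun k _ => ?_
            rw [← mul_assoc, ← map_mul]
    · intro h01
      have := congrArg (fun u : TAlg S (ZMod p) => u.coef 0) h01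
      simp [hR.one_eq] at this
  -- `(p)` is the kernel of the reduction, which maps onto a field
  letI := hF.toField
  let g : 𝓞 K →+* TAlg S (ZMod p) := red.comp e.symm.toRingHom
  have hsurj : Function.Surjective g := by
    intro v
    refine ⟨e ⟨fun a => ((v.coef a).val : ℤ)⟩, ?_⟩
    show red (e.symm (e _)) = v
    rw [RingEquiv.symm_apply_apply]
    ext a
    simp [hred, TAlg.map_coef]
  have hker : RingHom.ker g = span {(p : 𝓞 K)} := by
    apply le_antisymm
    · intro x hx
      rw [RingHom.mem_ker] at hx
      have hx' : TAlg.map (Int.castRingHom (ZMod p)) (e.symm x) = 0 := hx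
      obtain ⟨y, hy⟩ := TAlg.exists_eq_natCast_mul_of_map_eq_zero p hx'
      rw [mem_span_singleton]
      refine ⟨e y, ?_⟩
      calc x = e (e.symm x) := (e.apply_symm_apply x).symm
        _ = e ((p : TAlg S ℤ) * y) := by rw [hy]
        _ = (p : 𝓞 K) * e y := by rw [map_mul, map_natCast]
    · rw [span_singleton_le_iff_mem, RingHom.mem_ker]
      show red (e.symm (p : 𝓞 K)) = 0
      rw [map_natCast, map_natCast]
      ext a
      simp [TAlg.natCast_coef]
  have hmax : (span {(p : 𝓞 K)}).IsMaximal := hker ▸ RingHom.ker_isMaximal_of_surjective g hsurj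
  exact (hmax.eq_of_le hQ.ne_top ((span_singleton_le_iff_mem _).mpr hpQ)).symm

end InertNF

/-! ### Totally ramified primes from a nilpotent `ε` -/

section Ramified

open Ideal NumberField

variable {C : FieldData} {S : TableSpec 5} [Fact S.IsRing] (hR : Reads C S)
variable {K : Type} [Field K] [NumberField K] (e : TAlg S ℤ ≃+* 𝓞 K)
include hR

/-- **A totally ramified prime package from `ε = g₀ - c`**: if the constant vector `(c, …, c)` is a
verified homomorphism modulo a prime `q`, `ε⁵ ∈ qΛ`, and the powers of `ε̄` span `Λ/qΛ`, then
`P = ker(ψ_c)` satisfies `P⁵ = (q)` and is the only prime above `q`. [folklore] -/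
noncomputable def Reads.ramPrime (hdeg : Module.finrank ℚ K = 5) {q c : ℕ} (hq : q.Prime)
    (hc : C.isHom q ⟨c, c, c, c, c⟩ = true) (w : TAlg S ℤ)
    (hε5 : (TAlg.basis 0 - (c : TAlg S ℤ)) ^ 5 = (q : TAlg S ℤ) * w) (B : Fin 5 → Fin 5 → ZMod q)
    (hB : ∀ b, (TAlg.basis b : TAlg S (ZMod q)) =
      ∑ k : Fin 5, TAlg.const (B b k) * (TAlg.basis 0 - (c : TAlg S (ZMod q))) ^ (k : ℕ)) :
    RamPrime K q := by
  classical
  haveI := Fact.mk hq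
  let ψ : 𝓞 K →+* ZMod q := hR.homK e hq.pos hc
  let P : Ideal (𝓞 K) := RingHom.ker ψ
  have hsurj : Function.Surjective ψ := ZMod.ringHom_surjective ψ
  haveI hPmax : P.IsMaximal := RingHom.ker_isMaximal_of_surjective ψ hsurj
  -- `ε ∈ P`
  set ε : TAlg S ℤ := TAlg.basis 0 - (c : TAlg S ℤ) with hεdef
  have hψε : hR.homOf hq.pos hc ε = 0 := by
    rw [hεdef, map_sub, hR.homOf_basis, map_natCast]
    simp [N5.toFin]
  have hεP : e ε ∈ P := by
    show ψ (e ε) = 0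
    rw [hR.homK_apply_e]; exact hψε
  -- every prime `Q ∋ q` contains `e ε`, and every `x` with `ψ x = 0` lies in `(q, e ε)`
  have hqP : (q : 𝓞 K) ∈ P := by
    show ψ q = 0; rw [map_natCast, ZMod.natCast_self]
  have hεQ : ∀ Q : Ideal (𝓞 K), Q.IsPrime → (q : 𝓞 K) ∈ Q → e ε ∈ Q := fun Q hQ hqQ => by
    apply hQ.mem_of_pow_mem 5
    rw [← map_pow, hε5, map_mul, map_natCast]
    exact Q.mul_mem_right _ hqQ
  -- `P ≤ span {q, e ε}`: expand modulo `q` on the powers of `ε̄`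
  have hPle : P ≤ span {(q : 𝓞 K)} ⊔ span {e ε} := by
    intro x hx
    have hx0 : ψ x = 0 := hx
    set y := e.symm x with hydef
    have hxy : x = e y := (e.apply_symm_apply x).symm
    -- reduce `y` modulo `q` and expand
    set red : TAlg S ℤ →+* TAlg S (ZMod q) := TAlg.map (Int.castRingHom (ZMod q)) with hred
    have hredε : red ε = TAlg.basis 0 - (c : TAlg S (ZMod q)) := by
      rw [hεdef, map_sub, map_natCast, hred, map_basis]
    have hexp := TAlg.eq_sum_pow_of_basis (red ε) B (fun b => by rw [hredε]; exact hB b) (red y)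
    -- split off the constant coefficient: `red y = A 0 + red ε * z`
    set A : Fin 5 → TAlg S (ZMod q) := fun k => TAlg.const (∑ b, (red y).coef b * B b k) with hAdef
    have hexp' : red y = ∑ k : Fin 5, A k * red ε ^ (k : ℕ) := hexp
    have hsplit : ∃ z : TAlg S (ZMod q), red y = A 0 + red ε * z := by
      refine ⟨A 1 + A 2 * red ε + A 3 * red ε ^ 2 + A 4 * red ε ^ 3, ?_⟩
      conv_lhs => rw [hexp']
      rw [Fin.sum_univ_five]
      simp only [Fin.val_zero, Fin.val_one, Fin.val_two, show ((3 : Fin 5) : ℕ) = 3 from rfl,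
        show ((4 : Fin 5) : ℕ) = 4 from rfl, pow_zero, mul_one, pow_one]
      ring
    obtain ⟨z, hz⟩ := hsplit
    -- lift `z` and `A 0` to `ℤ`
    obtain ⟨z', hz'⟩ : ∃ z' : TAlg S ℤ, red z' = z := by
      refine ⟨⟨fun b => ((z.coef b).val : ℤ)⟩, ?_⟩; ext b; simp [hred]
    obtain ⟨a0, ha0⟩ : ∃ a0 : ℤ, TAlg.const ((a0 : ℤ) : ZMod q) = A 0 :=
      ⟨(∑ b, (red y).coef b * B b 0).val, by rw [hAdef]; simp⟩
    have hdiff : red (y - (a0 : TAlg S ℤ) - ε * z') = 0 := by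
      rw [map_sub, map_sub, map_mul, hz', map_intCast', Int.coe_castRingHom, ha0, hz]; ring
    obtain ⟨t, ht⟩ := TAlg.exists_eq_natCast_mul_of_map_eq_zero q hdiff
    -- apply `homOf`: `ψ(y) = a0 · ψ(1) + ψ(ε) ψ(z') + q(…) = a0`
    have hψy : hR.homOf hq.pos hc y = 0 := by
      have : hR.homK e hq.pos hc x = 0 := hx0
      rwa [hxy, hR.homK_apply_e] at this
    have ha00 : (a0 : ZMod q) = 0 := by
      have h1 := congrArg (hR.homOf hq.pos hc) ht
      rw [map_sub, map_sub, map_mul, hψy, hψε, zero_mul, sub_zero, zero_sub, map_mul, map_natCast,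
        ZMod.natCast_self, zero_mul, neg_eq_zero] at h1
      -- `homOf (a0 : TAlg) = a0 * Σ c = a0 · homOf 1 = a0`
      rwa [map_intCast] at h1
    -- conclude: `y = q t + a0 + ε z'` with `q ∣ a0`
    have hqa0 : (q : ℤ) ∣ a0 := (ZMod.intCast_zmod_eq_zero_iff_dvd a0 q).mp ha00
    obtain ⟨a1, rfl⟩ := hqa0
    have hy : y = (q : TAlg S ℤ) * (t + (a1 : TAlg S ℤ)) + ε * z' := by
      have := ht
      push_cast at this ⊢
      linear_combination this
    rw [hxy, hy, map_add, map_mul, map_mul, map_natCast]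
    exact Submodule.add_mem_sup (mem_span_singleton'.mpr ⟨e (t + (a1 : TAlg S ℤ)), mul_comm _ _⟩)
      (mem_span_singleton'.mpr ⟨e z', mul_comm _ _⟩)
  -- hence `P = (q) ⊔ (e ε)` and `P⁵ ≤ (q)`
  have hPeq : P = span {(q : 𝓞 K)} ⊔ span {e ε} :=
    le_antisymm hPle (sup_le ((span_singleton_le_iff_mem _).mpr hqP) ((span_singleton_le_iff_mem _).mpr hεP))
  have hP5le : P ^ 5 ≤ span {(q : 𝓞 K)} := by
    rw [← Ideal.mk_ker (I := span {(q : 𝓞 K)}), ← Ideal.map_eq_bot_iff_le_ker, Ideal.map_pow, hPeq, Ideal.map_sup,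
      Ideal.map_quotient_self, bot_sup_eq, Ideal.map_span, Set.image_singleton, Ideal.span_singleton_pow,
      Ideal.span_singleton_eq_bot, ← map_pow, ← map_pow, hε5, map_mul, map_natCast, Ideal.Quotient.eq_zero_iff_mem]
    exact Ideal.mul_mem_right _ _ (mem_span_singleton_self _)
  have hNP : absNorm P = q := by
    rw [absNorm_apply, Submodule.cardQuot_apply]
    have hc := Nat.card_congr (RingHom.quotientKerEquivOfSurjective hsurj).toEquiv
    rw [Nat.card_zmod] at hc
    exact hc
  have hpow : P ^ 5 = span {(q : 𝓞 K)} :=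
    eq_of_le_of_absNorm_eq hP5le (by rw [absNorm_span_natCast hdeg, map_pow, hNP])
      (by rw [map_pow, hNP]; exact pow_ne_zero _ hq.ne_zero)
  refine ⟨P, hpow, fun Q hQ hqQ => ?_⟩
  have hle : P ≤ Q := by
    rw [hPeq]
    exact sup_le ((span_singleton_le_iff_mem _).mpr hqQ) ((span_singleton_le_iff_mem _).mpr (hεQ Q hQ hqQ))
  exact (hPmax.eq_of_le hQ.ne_top hle).symm

end Ramified

/-! ### Soundness of the sieve and of the scan -/

section Sieve

/-- Bits of the geometric series: `testBit (Σ_{i<n} 2^{di}) m ↔ d ∣ m ∧ m/d < n` (`d ≥ 1`). [folklore] -/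
theorem testBit_geomMask {d : ℕ} (hd : 1 ≤ d) (n m : ℕ) :
    Nat.testBit (geomMask d n) m = true → d ∣ m ∧ m / d < n := by
  -- `geomMask d n = Σ_{i<n} (2^d)^i`
  have h2d : 2 ≤ 2 ^ d := by
    calc (2 : ℕ) = 2 ^ 1 := by norm_num
      _ ≤ 2 ^ d := Nat.pow_le_pow_right (by norm_num) hd
  have hsum : geomMask d n = ∑ i ∈ Finset.range n, 2 ^ (d * i) := by
    unfold geomMask
    rw [rawDiv, rawSub, rawSub, rawMul, rawPow, rawPow]
    rw [show (2 : ℕ) ^ (d * n) = (2 ^ d) ^ n by rw [pow_mul], ← Nat.geomSum_eq h2d n]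
    exact Finset.sum_congr rfl fun i _ => by rw [pow_mul]
  rw [hsum]
  clear hsum
  induction n generalizing m with
  | zero => simp
  | succ n ih =>
    rw [Finset.sum_range_succ]
    intro hbit
    -- the sum of the first `n` terms is `< 2^{dn}`
    have hlt : ∑ i ∈ Finset.range n, 2 ^ (d * i) < 2 ^ (d * n) := by
      have := Nat.geomSum_lt (m := 2 ^ d) (s := Finset.range n) (n := n) h2d (fun k hk => Finset.mem_range.mp hk)
      rw [← pow_mul] at this
      refine lt_of_le_of_lt (le_of_eq ?_) this
      exact Finset.sum_congr rfl fun i _ => by rw [pow_mul]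
    rcases Nat.lt_trichotomy m (d * n) with hm | hm | hm
    · -- lower bit: comes from the first `n` terms
      rw [add_comm, Nat.testBit_two_pow_add_gt hm] at hbit
      obtain ⟨h1, h2⟩ := ih m hbit
      exact ⟨h1, Nat.lt_succ_of_lt h2⟩
    · subst hm
      refine ⟨Dvd.intro n rfl, ?_⟩
      rw [Nat.mul_div_cancel_left _ hd]
      exact Nat.lt_succ_self n
    · -- higher bit: impossible
      exfalso
      have hsmall : ∑ i ∈ Finset.range n, 2 ^ (d * i) + 2 ^ (d * n) < 2 ^ m := by
        calc _ < 2 ^ (d * n) + 2 ^ (d * n) := by omega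
          _ = 2 ^ (d * n + 1) := by rw [pow_succ]; ring
          _ ≤ 2 ^ m := Nat.pow_le_pow_right (by norm_num) hm
      rw [Nat.testBit_lt_two_pow hsmall] at hbit
      exact Bool.false_ne_true hbit

/-- **Bits of the multiples mask are proper multiples**: `testBit (multMask M d) m → d ∣ m ∧ 2d ≤ m`
(`d ≥ 1`). [folklore] -/
theorem dvd_of_testBit_multMask {M d m : ℕ} (hd : 1 ≤ d) (h : Nat.testBit (multMask M d) m = true) :
    d ∣ m ∧ 2 * d ≤ m := by
  unfold multMask at h
  rw [rawShiftLeft, rawMul, Nat.testBit_shiftLeft] at h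
  simp only [ge_iff_le, Bool.and_eq_true, decide_eq_true_eq] at h
  obtain ⟨hle, hbit⟩ := h
  obtain ⟨hdvd, -⟩ := testBit_geomMask hd _ _ hbit
  refine ⟨?_, hle⟩
  have : d ∣ m - 2 * d + 2 * d := Nat.dvd_add hdvd (Dvd.intro_left 2 rfl)
  rwa [Nat.sub_add_cancel hle] at this

/-- **Marked numbers are composite**: a set bit of `compMaskF M n` at `m` gives a divisor `d` of `m`
with `2 ≤ d` and `2d ≤ m`, so `m` is not prime. [folklore] -/
theorem not_prime_of_testBit_compMaskF (M : ℕ) : ∀ (n m : ℕ), Nat.testBit (compMaskF M n) m = true → ¬ m.Prime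
  | 0, m, h => by simp [compMaskF] at h
  | n + 1, m, h => by
    unfold compMaskF at h
    rw [show Nat.lor (compMaskF M n) (multMask M (Nat.add n 2)) = compMaskF M n ||| multMask M (n + 2) from rfl,
      Nat.testBit_or, Bool.or_eq_true] at h
    rcases h with h | h
    · exact not_prime_of_testBit_compMaskF M n m h
    · obtain ⟨hdvd, hle⟩ := dvd_of_testBit_multMask (by omega) h
      intro hp
      rcases (Nat.dvd_prime hp).mp hdvd with h1 | h2
      · omega
      · omega

/-- Bits of `compMask M` mark composite numbers only. [folklore] -/
theorem not_prime_of_testBit_compMask {M m : ℕ} (h : Nat.testBit (compMask M) m = true) : ¬ m.Prime :=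
  not_prime_of_testBit_compMaskF M 598 m h

end Sieve

section Scan

/-- **Soundness of the inner scan**: if `scan` succeeds on `fuel` numbers from `n` with a bit source `w`
whose set bits mark non-primes, every prime `q ≤ M`, `q ∉ {11, 241}`, in the window has an accepted
record. [folklore] -/
theorem FieldData.scan_sound (C : FieldData) (M : ℕ) : ∀ (fuel n w : ℕ) (recs : List Rec) (rest : List Rec),
    C.scan M fuel n w recs = some rest →
    (∀ i, i < fuel → Nat.testBit w i = true → ¬ (n + i).Prime) →
    ∀ q, n ≤ q → q < n + fuel → q.Prime → q ≤ M → q ≠ 11 → q ≠ 241 →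
      ∃ R ∈ recs, R.p = q ∧ C.checkRec M R = true
  | 0, n, w, recs, rest, _, _, q, h1, h2, _, _, _, _ => by omega
  | fuel + 1, n, w, recs, rest, hscan, hw, q, hnq, hqf, hq, hqM, h11, h241 => by
    unfold FieldData.scan at hscan
    -- the bit source for the tail
    have hw' : ∀ i, i < fuel → Nat.testBit (Nat.shiftRight w 1) i = true → ¬ (n + 1 + i).Prime := by
      intro i hi hb
      rw [rawShiftRight, Nat.testBit_shiftRight] at hb
      have := hw (1 + i) (by omega) hb
      rwa [show n + (1 + i) = n + 1 + i by omega] at this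
    by_cases hskip : (Nat.beq (Nat.land w 1) 1 || Nat.blt n 2 || Nat.blt M n || Nat.beq n 11 || Nat.beq n 241) = true
    · rw [hskip, cond_true] at hscan
      rcases Nat.eq_or_lt_of_le hnq with rfl | hlt
      · -- `q = n` cannot be a relevant prime
        exfalso
        simp only [Bool.or_eq_true] at hskip
        rcases hskip with (((hb | hb) | hb) | hb) | hb
        · have hb' : Nat.testBit w 0 = true := by
            rw [Nat.testBit_eq_decide_div_mod_eq]
            simp only [pow_zero, Nat.div_one, decide_eq_true_eq]
            have := Nat.eq_of_beq_eq_true hb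
            rw [rawLand, Nat.and_one_is_mod] at this
            exact this
          exact hw 0 (by omega) hb' (by simpa using hq)
        · have := Nat.blt_eq.mp hb
          exact absurd hq (by interval_cases n <;> decide)
        · have := Nat.blt_eq.mp hb; omega
        · exact h11 (Nat.eq_of_beq_eq_true hb)
        · exact h241 (Nat.eq_of_beq_eq_true hb)
      · exact FieldData.scan_sound C M fuel (n + 1) _ recs rest hscan hw' q hlt (by omega) hq hqM h11 h241
    · rw [Bool.not_eq_true] at hskip
      rw [hskip, cond_false] at hscan
      cases recs with
      | nil => simp at hscan
      | cons R recs' =>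
        simp only at hscan
        by_cases hR : (Nat.beq R.p n && C.checkRec M R) = true
        · rw [hR, cond_true] at hscan
          simp only [Bool.and_eq_true] at hR
          rcases Nat.eq_or_lt_of_le hnq with rfl | hlt
          · exact ⟨R, List.mem_cons_self, Nat.eq_of_beq_eq_true hR.1, hR.2⟩
          · obtain ⟨R', hR', hp', hc'⟩ := FieldData.scan_sound C M fuel (n + 1) _ recs' rest hscan hw' q hlt (by omega) hq hqM h11 h241
            exact ⟨R', List.mem_cons_of_mem _ hR', hp', hc'⟩
        · rw [Bool.not_eq_true] at hR
          rw [hR, cond_false] at hscan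
          exact absurd hscan (by simp)

/-- The records left over by `scan` are among the given ones. [folklore] -/
theorem FieldData.scan_sublist (C : FieldData) (M : ℕ) : ∀ (fuel n w : ℕ) (recs rest : List Rec),
    C.scan M fuel n w recs = some rest → ∀ {R : Rec}, R ∈ rest → R ∈ recs
  | 0, n, w, recs, rest, h, R, hR => by
    unfold FieldData.scan at h
    simp only [Option.some.injEq] at h
    rwa [← h] at hR
  | fuel + 1, n, w, recs, rest, h, R, hR => by
    unfold FieldData.scan at h
    by_cases hskip : (Nat.beq (Nat.land w 1) 1 || Nat.blt n 2 || Nat.blt M n || Nat.beq n 11 || Nat.beq n 241) = true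
    · rw [hskip, cond_true] at h
      exact FieldData.scan_sublist C M fuel _ _ recs rest h hR
    · rw [Bool.not_eq_true] at hskip
      rw [hskip, cond_false] at h
      cases recs with
      | nil => simp at h
      | cons R₀ recs' =>
        simp only at h
        by_cases hR₀ : (Nat.beq R₀.p n && C.checkRec M R₀) = true
        · rw [hR₀, cond_true] at h
          exact List.mem_cons_of_mem _ (FieldData.scan_sublist C M fuel _ _ recs' rest h hR)
        · rw [Bool.not_eq_true] at hR₀
          rw [hR₀, cond_false] at h
          exact absurd h (by simp)

set_option exponentiation.threshold 2048 in
/-- **Soundness of the block scan.** [folklore] -/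
theorem FieldData.scanBlocks_sound (C : FieldData) (M : ℕ) : ∀ (nb lo : ℕ) (recs rest : List Rec),
    C.scanBlocks M (compMask M) nb lo recs = some rest →
    ∀ q, lo ≤ q → q < lo + 1024 * nb → q.Prime → q ≤ M → q ≠ 11 → q ≠ 241 →
      ∃ R ∈ recs, R.p = q ∧ C.checkRec M R = true
  | 0, lo, recs, rest, _, q, h1, h2, _, _, _, _ => by omega
  | nb + 1, lo, recs, rest, hsb, q, hlo, hhi, hq, hqM, h11, h241 => by
    unfold FieldData.scanBlocks at hsb
    simp only at hsb
    set w := Nat.land (Nat.shiftRight (compMask M) lo) (Nat.sub (Nat.pow 2 1024) 1) with hwdef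
    cases hsc : C.scan M 1024 lo w recs with
    | none => simp [hsc] at hsb
    | some recs' =>
      simp only [hsc] at hsb
      have hw : ∀ i, i < 1024 → Nat.testBit w i = true → ¬ (lo + i).Prime := by
        intro i hi hb
        rw [hwdef, rawLand, rawShiftRight, rawSub, rawPow, Nat.testBit_and, Nat.testBit_shiftRight,
          Nat.testBit_two_pow_sub_one, Bool.and_eq_true] at hb
        exact not_prime_of_testBit_compMask hb.1
      by_cases hql : q < lo + 1024
      · exact FieldData.scan_sound C M 1024 lo w recs recs' hsc hw q hlo hql hq hqM h11 h241
      · -- later block: the record lies in `recs'`, hence in `recs`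
        obtain ⟨R, hR, hp, hc⟩ := FieldData.scanBlocks_sound C M nb (Nat.add lo 1024) recs' rest hsb q
          (by rw [rawAdd]; omega) (by rw [rawAdd]; omega) hq hqM h11 h241
        exact ⟨R, FieldData.scan_sublist C M 1024 lo w recs recs' hsc hR, hp, hc⟩

end Scan

/-! ### Assembly: the class group has odd order -/

section Assembly

open Ideal NumberField
open scoped nonZeroDivisors

variable {C : FieldData} {S : TableSpec 5} [Fact S.IsRing] (hR : Reads C S)
variable {K : Type} [Field K] [NumberField K] (e : TAlg S ℤ ≃+* 𝓞 K)
variable (hsym : S.IsSymmetry (Equiv.addRight (4 : Fin 5)))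

omit [Fact S.IsRing] hR [NumberField K] in
/-- A prime ideal containing a natural number `n ≥ 1` contains a prime factor of `n`. [folklore] -/
theorem exists_prime_mem_of_natCast_mem {Q : Ideal (𝓞 K)} (hQ : Q.IsPrime) :
    ∀ n : ℕ, 1 ≤ n → (n : 𝓞 K) ∈ Q → ∃ q : ℕ, q.Prime ∧ q ∣ n ∧ (q : 𝓞 K) ∈ Q := by
  intro n
  induction n using Nat.strong_induction_on with
  | _ n ih =>
    intro h1 hn
    rcases Nat.eq_or_lt_of_le h1 with rfl | hlt
    · exact absurd (Q.eq_top_of_isUnit_mem (by simpa using hn) isUnit_one) hQ.ne_top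
    · have hn1 : n ≠ 1 := by omega
      have hq : n.minFac.Prime := Nat.minFac_prime hn1
      obtain ⟨m, hm⟩ := Nat.minFac_dvd n
      have hn' : ((n.minFac : ℕ) : 𝓞 K) * (m : 𝓞 K) ∈ Q := by
        rw [← Nat.cast_mul, ← hm]; exact hn
      rcases hQ.mem_or_mem hn' with h | h
      · exact ⟨n.minFac, hq, Nat.minFac_dvd n, h⟩
      · have hm1 : 1 ≤ m := by
          rcases Nat.eq_zero_or_pos m with rfl | hpos
          · rw [mul_zero] at hm; omega
          · exact hpos
        have hmlt : m < n := by
          have h2 := hq.two_le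
          calc m < 2 * m := by omega
            _ ≤ n.minFac * m := Nat.mul_le_mul_right m h2
            _ = n := hm.symm
        obtain ⟨q, hq', hqd, hqm⟩ := ih m hmlt hm1 h
        exact ⟨q, hq', hqd.trans (Dvd.intro_left _ hm.symm), hqm⟩

variable (hdeg : Module.finrank ℚ K = 5)
variable (hnorm : ∀ (u : Z5) (n : ℤ), (Z5.norm C.mul u).isConst n = true → Algebra.norm ℤ (e (toT S u)) = n)
variable (hnormShift : ∀ u : TAlg S ℤ, Algebra.norm ℤ (e (shiftInv hsym u)) = Algebra.norm ℤ (e u))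
variable (R11 : RamPrime K 11) (R241 : RamPrime K 241)
variable (hf0 : (TAlg.basis 0 : TAlg S ℤ) ^ 5 + (C.f.a4 : TAlg S ℤ) * TAlg.basis 0 ^ 4 +
    (C.f.a3 : TAlg S ℤ) * TAlg.basis 0 ^ 3 + (C.f.a2 : TAlg S ℤ) * TAlg.basis 0 ^ 2 +
    (C.f.a1 : TAlg S ℤ) * TAlg.basis 0 + (C.f.a0 : TAlg S ℤ) = 0)
variable (hDex : ∀ b : Fin 5, ∃ c : Fin 5 → ℤ,
    (C.D : TAlg S ℤ) * TAlg.basis b = ∑ k : Fin 5, (c k : TAlg S ℤ) * TAlg.basis 0 ^ (k : ℕ))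
variable {M : ℕ} (hM64 : M < 2 ^ 64)
variable (chunks : List (ℕ × ℕ × List Rec))
variable (hcover : ∀ q : ℕ, 2 ≤ q → q ≤ M → ∃ ch ∈ chunks, ch.1 ≤ q ∧ q < ch.1 + 1024 * ch.2.1)
variable (hcheck : ∀ ch ∈ chunks, C.checkRange M (compMask M) ch.1 ch.2.1 ch.2.2 = true)
include hR hdeg hnorm hnormShift R11 R241 hf0 hDex hM64 hcover hcheck

/-- **Every prime ideal of norm `≤ M` has principal `25`-th power.** [folklore] -/
theorem Reads.prime_pow_isPrincipal {Q : Ideal (𝓞 K)} [hQ : Q.IsPrime] (hQ0 : Q ≠ ⊥) (hQM : absNorm Q ≤ M) :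
    (Q ^ 25).IsPrincipal := by
  classical
  -- the prime `q` under `Q`
  have hN1 : 1 ≤ absNorm Q := Nat.one_le_iff_ne_zero.mpr (by rwa [Ne, absNorm_eq_zero_iff])
  obtain ⟨q, hq, -, hqQ⟩ := exists_prime_mem_of_natCast_mem hQ (absNorm Q) hN1 (absNorm_mem Q)
  -- `q ≤ M`
  have hqM : q ≤ M := by
    have hdvd : absNorm Q ∣ q ^ 5 := by
      rw [← absNorm_span_natCast (K := K) hdeg q]
      exact absNorm_dvd_absNorm_of_le ((span_singleton_le_iff_mem _).mpr hqQ)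
    obtain ⟨i, -, hNi⟩ := (Nat.dvd_prime_pow hq).mp hdvd
    have hi0 : i ≠ 0 := fun h0 => by
      rw [h0, pow_zero, absNorm_eq_one_iff] at hNi; exact hQ.ne_top hNi
    calc q = q ^ 1 := (pow_one q).symm
      _ ≤ q ^ i := Nat.pow_le_pow_right hq.pos (Nat.one_le_iff_ne_zero.mpr hi0)
      _ = absNorm Q := hNi.symm
      _ ≤ M := hQM
  -- ramified primes
  by_cases h11 : q = 11
  · subst h11
    have : Q = R11.P := R11.unique Q hQ hqQ
    rw [this, show (25 : ℕ) = 5 * 5 by norm_num, pow_mul, R11.pow_eq, span_singleton_pow]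
    exact ⟨⟨_, rfl⟩⟩
  by_cases h241 : q = 241
  · subst h241
    have : Q = R241.P := R241.unique Q hQ hqQ
    rw [this, show (25 : ℕ) = 5 * 5 by norm_num, pow_mul, R241.pow_eq, span_singleton_pow]
    exact ⟨⟨_, rfl⟩⟩
  -- the certificate record of `q`
  obtain ⟨ch, hch, hlo, hhi⟩ := hcover q hq.two_le hqM
  have hrange := hcheck ch hch
  unfold FieldData.checkRange at hrange
  cases hsb : C.scanBlocks M (compMask M) ch.2.1 ch.1 ch.2.2 with
  | none => simp [hsb] at hrange
  | some rest =>
    obtain ⟨R, -, hRp, hRc⟩ := FieldData.scanBlocks_sound C M ch.2.1 ch.1 ch.2.2 rest hsb q hlo hhi hq hqM h11 h241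
    have hq64 : q < 2 ^ 64 := lt_of_le_of_lt hqM hM64
    cases R with
    | split p r ho h5o β a b neg =>
      simp only [Rec.p] at hRp
      rw [hRp] at hRc
      exact hR.pow_isPrincipal_of_split e hsym hnorm hnormShift R11 R241 hdeg hq hRc hqQ
    | inert p s s2 =>
      simp only [Rec.p] at hRp
      rw [hRp] at hRc
      unfold FieldData.checkRec at hRc
      simp only [Bool.and_eq_true, Bool.or_eq_true] at hRc
      obtain ⟨hnr, hrest⟩ := hRc
      rcases hrest with hbig | ⟨hD, hirr⟩
      · exact absurd (no_prime_le_of_inert_large e hf0 hdeg hq hq64 hnr (Nat.blt_eq.mp hbig) hqQ hQM) id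
      · cases s2 with
        | none => simp at hirr
        | some s2 =>
          have hD' : ¬ q ∣ C.D := by
            intro hdvd
            have hz : Nat.beq (Nat.mod C.D q) 0 = true := by
              rw [rawMod, Nat.mod_eq_zero_of_dvd hdvd]; rfl
            rw [hz] at hD
            simp at hD
          simp only at hirr
          have hQeq := eq_span_of_inert_small hR e hf0 hq hq64 hD' hDex hirr hqQ
          rw [hQeq, span_singleton_pow]
          exact ⟨⟨_, rfl⟩⟩

/-- **Every non-zero ideal of norm `≤ M` has principal `25`-th power.** [folklore] -/
theorem Reads.pow_isPrincipal_of_absNorm_le (I : Ideal (𝓞 K)) :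
    I ≠ ⊥ → absNorm I ≤ M → (I ^ 25).IsPrincipal := by
  refine UniqueFactorizationMonoid.induction_on_prime I (fun h => absurd rfl h) ?_ ?_
  · intro J hJ _ _
    rw [Ideal.isUnit_iff.mp hJ, ← Ideal.one_eq_top, one_pow, Ideal.one_eq_top]
    exact top_isPrincipal
  · intro J Q hJ0 hQ ih _ hN
    haveI hQp : Q.IsPrime := Ideal.isPrime_of_prime hQ
    have hQ0 : Q ≠ ⊥ := hQ.ne_zero
    have hNJ : 1 ≤ absNorm J := Nat.one_le_iff_ne_zero.mpr (by rwa [Ne, absNorm_eq_zero_iff])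
    have hNQ : 1 ≤ absNorm Q := Nat.one_le_iff_ne_zero.mpr (by rwa [Ne, absNorm_eq_zero_iff])
    rw [map_mul] at hN
    have hQM : absNorm Q ≤ M := le_trans (Nat.le_mul_of_pos_right _ hNJ) hN
    have hJM : absNorm J ≤ M := le_trans (Nat.le_mul_of_pos_left _ hNQ) hN
    obtain ⟨x, hx⟩ := (hR.prime_pow_isPrincipal e hsym hdeg hnorm hnormShift R11 R241 hf0 hDex hM64 chunks hcover hcheck hQ0 hQM)
    obtain ⟨y, hy⟩ := ih hJ0 hJM
    refine ⟨⟨x * y, ?_⟩⟩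
    rw [mul_pow, show Q ^ 25 = span {x} from hx, show J ^ 25 = span {y} from hy, Ideal.span_singleton_mul_span_singleton,
      Ideal.submodule_span_eq]

variable (hMink : ∀ c : ClassGroup (𝓞 K), ∃ I : (Ideal (𝓞 K))⁰, ClassGroup.mk0 I = c ∧ absNorm (I : Ideal (𝓞 K)) ≤ M)
include hMink

/-- **The class group has exponent dividing `25`.** [folklore] -/
theorem Reads.classGroup_pow_eq_one (c : ClassGroup (𝓞 K)) : c ^ 25 = 1 := by
  obtain ⟨I, rfl, hI⟩ := hMink c
  rw [← map_pow, ClassGroup.mk0_eq_one_iff]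
  have := hR.pow_isPrincipal_of_absNorm_le e hsym hdeg hnorm hnormShift R11 R241 hf0 hDex hM64 chunks hcover hcheck
    (I : Ideal (𝓞 K)) (nonZeroDivisors.coe_ne_zero I) hI
  simpa using this

/-- **Main theorem: the class group has no `2`-torsion** — an ideal whose square is principal is
principal. [folklore] -/
theorem Reads.isPrincipal_of_sq_isPrincipal {I : Ideal (𝓞 K)} (hI0 : I ≠ ⊥) (hI : (I ^ 2).IsPrincipal) :
    I.IsPrincipal := by
  set I' : (Ideal (𝓞 K))⁰ := ⟨I, mem_nonZeroDivisors_of_ne_zero hI0⟩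
  have h2 : ClassGroup.mk0 I' ^ 2 = 1 := by
    rw [← map_pow, ClassGroup.mk0_eq_one_iff]; exact hI
  have h25 := hR.classGroup_pow_eq_one e hsym hdeg hnorm hnormShift R11 R241 hf0 hDex hM64 chunks hcover hcheck hMink
    (ClassGroup.mk0 I')
  have h1 : ClassGroup.mk0 I' = 1 := by
    have : ClassGroup.mk0 I' = (ClassGroup.mk0 I') ^ 25 * ((ClassGroup.mk0 I') ^ 2)⁻¹ ^ 12 := by group
    rw [this, h25, h2]; group
  exact (ClassGroup.mk0_eq_one_iff (mem_nonZeroDivisors_of_ne_zero hI0)).mp h1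

end Assembly


end QuinticCert

end Literature.NumberTheory.NumberFields
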